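import Summits.AtomisticToContinuum.FouriersLaw.Theses.PhononMeanFreePath
import Summits.AtomisticToContinuum.FouriersLaw.Theorems.IncoherentChannel.Negative.HarmonicWick
import Summits.AtomisticToContinuum.FouriersLaw.Theorems.PhononMeanFreePathDefs
import Summits.AtomisticToContinuum.FouriersLaw.Theorems.PhononMeanFreePathIncoherentChannelCommonPastBound
import Summits.AtomisticToContinuum.FouriersLaw.Theorems.PhononMeanFreePathIncoherentChannelLightCone
import Summits.AtomisticToContinuum.FouriersLaw.Theorems.PhononMeanFreePathIncoherentChannelVarianceTransportHelper1
import Summits.AtomisticToContinuum.FouriersLaw.Theorems.PhononMeanFreePathIncoherentChannelVarianceLimitReduction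
import Summits.AtomisticToContinuum.FouriersLaw.Theorems.PhononMeanFreePathIncoherentChannelLineCensus
import Summits.AtomisticToContinuum.FouriersLaw.Theorems.PhononMeanFreePathIncoherentChannelContactLoss
import Summits.AtomisticToContinuum.FouriersLaw.Theorems.PhononMeanFreePathIncoherentChannelForecastBudget
import Summits.AtomisticToContinuum.FouriersLaw.Theorems.PhononMeanFreePathIncoherentChannelTimeResolvedBudget
import Summits.AtomisticToContinuum.FouriersLaw.Theorems.PhononMeanFreePathIncoherentChannelPersistence
import Summits.AtomisticToContinuum.FouriersLaw.Theorems.PhononMeanFreePathIncoherentChannelChannelBookkeeping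
import Summits.AtomisticToContinuum.FouriersLaw.Theorems.PhononMeanFreePathIncoherentChannelTimeReversalAssembly
import Summits.AtomisticToContinuum.FouriersLaw.Theorems.PhononMeanFreePathIncoherentChannelEchoStructure
import Summits.AtomisticToContinuum.FouriersLaw.Theorems.PhononMeanFreePathIncoherentChannelLeftSensitivityAssembly
import Summits.AtomisticToContinuum.FouriersLaw.Theorems.PhononMeanFreePathIncoherentChannelGlobalFlip
import Summits.AtomisticToContinuum.FouriersLaw.Theorems.PhononMeanFreePathIncoherentChannelSemigroupBudget
import Summits.AtomisticToContinuum.FouriersLaw.Theorems.PhononMeanFreePathIncoherentChannelShiftedDissipation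
import Summits.AtomisticToContinuum.FouriersLaw.Theorems.PhononMeanFreePathIncoherentChannelTailBudget
import Summits.AtomisticToContinuum.FouriersLaw.Theorems.PhononMeanFreePathIncoherentChannelLeftSensitivityTail
import Summits.AtomisticToContinuum.FouriersLaw.Theorems.PhononMeanFreePathIncoherentChannelOneTimeEngine
import Summits.AtomisticToContinuum.FouriersLaw.Theorems.PhononMeanFreePathIncoherentChannelCommonPastTail
import Summits.AtomisticToContinuum.FouriersLaw.Theorems.PhononMeanFreePathIncoherentChannelHarmonicTailBudget
import Summits.AtomisticToContinuum.FouriersLaw.Theorems.PhononMeanFreePathIncoherentChannelStrictForecastBudget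
import Summits.AtomisticToContinuum.FouriersLaw.Theorems.PhononMeanFreePathIncoherentChannelTimeWeightedBridge
import Summits.AtomisticToContinuum.FouriersLaw.Theorems.PhononMeanFreePathIncoherentChannelWitnessTimeResolved
import Summits.AtomisticToContinuum.FouriersLaw.Theorems.PhononMeanFreePathIncoherentChannelCoherentBudgetMonotone
import Summits.AtomisticToContinuum.FouriersLaw.Theorems.PhononMeanFreePathIncoherentChannelAnharmonicShortTimeLoss
import Summits.AtomisticToContinuum.FouriersLaw.Theorems.PhononMeanFreePathIncoherentChannelCumulantFloor
import Summits.AtomisticToContinuum.FouriersLaw.Theorems.PhononMeanFreePathIncoherentChannelLightConeRate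
import Summits.AtomisticToContinuum.FouriersLaw.Theorems.PhononMeanFreePathIncoherentChannelPostCone
import Summits.AtomisticToContinuum.FouriersLaw.Theorems.PhononMeanFreePathIncoherentChannelPostConeKubo
import Summits.AtomisticToContinuum.FouriersLaw.Theorems.PhononMeanFreePathIncoherentChannelPowerCovLightCone

/-!
# Line `two-horizons-forecast-loss` — crux `PhononMeanFreePath.IncoherentChannel` (stmt-AtomisticToContinuum-11811)

CONTINUATION LEAD c9, CYCLE 1 (prover-line-stmt-AtomisticToContinuum-11811-c9-0, 2026-08-17): skeleton taken over UNCHANGED in its core (rc 0;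
core sorries = `Holds.stub_forecastLoss`, `Holds.stub_varianceLimit`; c8 was a bookkeeping seat, verdict promote-stub), re-registered under this seat.
NEW THIS CYCLE — THE FOUR-POINT LIGHT CONE (registered stubs at the end of this file, section "Lead c9"): causality for the crux kernel
`C_N = Cov(p_0², K_t p_N²)` ITSELF (`powerCov_lightCone`, lead: Hölder reduction to the landed pathwise two-copy light cone, helper 7), the
abstract two-regime rate lemma (`lightCone_rate_of_sq_le`), D5 piece 1 of the strategist census for the FULL crux integrand
(`lightConePiece_of_powerCovLightCone`), and the POST-CONE NORMAL FORMS of the crux and of the conjunct (`incoherentChannel_iff_postCone_…`,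
`fouriersLaw_iff_postConeKubo_…`): for every `η ∈ (0,1)` only times `t > N^η` matter. Standing verdict promote-stub (core ≡ FouriersLaw mod engine).

CONTINUATION LEAD c7, CYCLE 1 (prover-line-stmt-AtomisticToContinuum-11811-c7-0, 2026-08-17): skeleton taken over UNCHANGED (rc 0;
sorries = `Holds.stub_forecastLoss`, `Holds.stub_varianceLimit`), re-registered under this seat; engine held. NEW THIS CYCLE — CROSS-CRUX
ACCOUNTING with the sibling crux `CoherentDephasing` (its line landed `N`-uniform STRICT ABSORPTION p135295 and the temporal child T1 p132858)
and the first `N`-UNIFORM use of anharmonicity on the forecast norm itself (wave of three workers + three lead files, all ACCEPTED `--supports`):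
(i) `…StrictForecastBudget.lean` (W-A, p157590) — `a_N = m_0` by site reflection and the **`N`-UNIFORM STRICT FORECAST BUDGET**
`∫₀^∞(r_N² + a_N²) ≤ T²/(2γ) − c` (`N ≥ 2`): the budget p135026 is saturated (`= T²/(2γ)`, p155547) IFF `lam = β = 0`;
(ii) `…TimeWeightedBridge.lean` (W-B, p157582) — the registered engine gives the sibling's T1 hypothesis, hence a SECOND composition
engine ⇒ `CoherentDephasing` through the sibling's glue (`coherentDephasing_of_stub1_viaT1`); (iii) `…WitnessTimeResolved.lean` (W-C, p158070) —
the witnessed Landauer bound with the forecast-norm term kept; (iv) `…CoherentBudgetMonotone.lean` (lead, p158264) — the coherent budget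
`S_N(t) + (2γ/T)∫₀ᵗ(r_N² + a_N²)` is non-increasing; (v) `…AnharmonicShortTimeLoss.lean` (lead, p158540) — **`N`-UNIFORM ANHARMONIC LOSS**:
`∃ c, r₀ > 0, ∀ N ≥ 2, ∀ t ≥ 0: S_N(t) + (2γ/T)∫₀ᵗ(r_N² + a_N²) ≤ T − c·(min t r₀)⁵`, while at `lam = β = 0` the left side `= T`
identically (`engine_harmonic_budget_identity`, from p155138). (vi) `…CumulantFloor.lean` (lead) — the `N`-uniform CUMULANT FLOOR `∫₀^∞(C_N − 2r_N²) + ∫₀^∞(A_N − 2a_N²) ≥ c > 0`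
(`N ≥ 2`; strict budget + the KDN sum rule): the crux (far share `= κT²/(γ²N)(1+o(1))`) forces the NEAR cumulant channel to stay order one.
Census also records `engine_fixedN`: the registered engine with QUANTIFIERS
SWAPPED (`∀ N ∃ C α > 2`) is a theorem (`fnorm_le_exp`, p87312) — the engine's entire open content is the uniformity of `(C, α)` in `N`.
HONEST CENSUS: both open stubs unchanged in kind (engine held: what is missing is `N`-uniform decay to ZERO of the escaped fraction = the
sibling's open stub `stub_blockLossBound` in forecast clothes; core ≡ FouriersLaw mod engine, p115953); standing verdict promote-stub.

CONTINUATION LEAD c6, CYCLE 1 (prover-line-stmt-AtomisticToContinuum-11811-c6-0, 2026-08-17): skeleton taken over UNCHANGED (rc 0;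
sorries = `Holds.stub_forecastLoss`, `Holds.stub_varianceLimit`), re-registered under this seat; engine held. NEW THIS CYCLE — THE HARMONIC
CORNER EXACTLY (calibration of the weakest registered engine form, the ONE-TIME hypothesis `N·S_N(N^η) → 0`, p149873; wave of five
workers, all ACCEPTED `--supports`, plus the lead's two assembly files): (i) `Theorems/…HarmonicForecast.lean` (p153741) — at `lam = β = 0` the
forecast IS the deterministic damped flow read on `p_N`, `v_t(z) = (Φ_t z)_{p_N}` (superposition + global-flip oddness), `r_N = T·(Φ_t e_{p_0})_{p_N}`,
`a_N = T·(Φ_t e_{p_N})_{p_N}`; (ii) `…HarmonicFlowDriftComm.lean` (p153765) — the linear flow commutes with its drift, `Φ_t∘Y = Y∘Φ_t`;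
(iii) `…GibbsKoopmanDissipation.lean` (p154074) — for EVERY continuous linear `L` and every chain of the family (`lam, β ≥ 0`):
`∫ L·(L∘Y) dμ_T = −γT Σ_b w_b L(e_{p_b})²` (antisymmetry of the Liouville operator in `L²(μ_T)` + Stein; no Gibbs covariance);
(iv) `…OneTimeCorner.lean` (p153760) — the corner-capable one-time composition; (v) `…HarmonicKineticMoment.lean` (p153976) — dominated
calculus of `∫((Φ_t z)_{p_i})² dμ_T` along the free flow. Lead: `…HarmonicDissipation.lean` (p155138) — **`dS_N/dt = −(2γ/T)(r_N² + a_N²)` EXACTLY at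
`lam = β = 0`** (the general chain has only `≤`, p136614, and only for `β > 0`) and the integrated tail identity; `…HarmonicTailBudget.lean` (p155547)
— the HARMONIC TAIL BUDGET `(2γ/T)∫_{t>t₁}(r²+a²) ≤ S_N(t₁)`, LaSalle `S_N(t) → 0`, hence EQUALITY and the **EXACT FORECAST SUM RULE
`∫₀^∞(r_N² + a_N²) = T²/(2γ)` for every `N`** (the `N`-uniform budget p135026 is saturated at the corner; `∫₀^∞ a_N² = T²/(2γ) − T²c_{N+1}/(2γ²)`:
transmitted RLL fraction + re-absorbed echo = 1, nothing dephased), **`oneTime_false_harmonic`** (at `lam = β = 0`, for EVERY `η ∈ (0,1)`,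
`¬(N·S_N(N^η) → 0)`) and its quantitative form **`harmonic_forecast_plateau`**: eventually in `N`, `S_N(t) ≥ T·c_∞/(2γ)` for all
`0 ≤ t ≤ N^η` (`c_∞ = fluxLimit ω₂ γ > 0`): the forecast skill carried by the transmitted wave cannot be spent before the wave reaches the far
bath. READING: the weakest engine form is calibrated exactly like the envelope form (p93738) — what `lam, β > 0` must destroy, `N`-uniformly
by time `N^η`, is a plateau of height `≥ T c_∞/(2γ)`. Kernel-checked restatements `engine_harmonic_dissipation`, `engine_harmonic_sumRule`,
`engine_harmonic_plateau`, `oneTime_false_harmonic'` at the end of this file. HONEST CENSUS: both open stubs unchanged in kind (engine held;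
core ≡ FouriersLaw mod engine, p115953); standing verdict promote-stub `stub_varianceLimit`.

CONTINUATION LEAD c5, CYCLE 1 (prover-line-stmt-AtomisticToContinuum-11811-c5-0, 2026-08-17): skeleton taken over UNCHANGED (rc 0;
sorries = `Holds.stub_forecastLoss`, `Holds.stub_varianceLimit`), re-registered under this seat; engine held. NEW THIS CYCLE — the
SEMIGROUP (TAIL) FORM OF THE DISSIPATION BUDGET (four workers, all ACCEPTED `--supports`) and its consequence, the ONE-TIME ENGINE:
(i) `Theorems/…SemigroupBudget.lean` (p144914) — the time-resolved forecast budget for GENERAL square-integrable data `F ∈ L²(μ₀)`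
(density of `C_c` + `L²`-contraction; reusable tool `semigroupBudget_sq_act_le`); (ii) `Theorems/…ShiftedDissipation.lean` (p145885) — the
dissipation inequality with carré du champ on a shifted window `(t₁, t₁+t]` (bounded continuous data + Chapman–Kolmogorov + Feller);
(iii) `Theorems/…TailBudget.lean` (p148747) — **TAIL BUDGET** `(2γ/T)∫_{t>t₁}(r_N² + a_N²) dt ≤ S_N(t₁)` for every `N`, `t₁ ≥ 0`
((i) at `F = v_{t₁}` + Chapman–Kolmogorov): the whole coherent budget still unspent at time `t₁` is at most `(T/2γ)·S_N(t₁)`;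
(iv) `Theorems/…LeftSensitivityTail.lean` (p147650) — `∫_{(0,t]} D_N(t₁+s) ds ≤ π²/(8γ)·S_N(t₁)`, hence (lead, `…CommonPastTail.lean`)
`∫₀^∞ P_N(t₁+s)² ds ≤ K²π²/(8γ)·S_N(t₁)`: after time `t₁` EVERY cross quantity of the line (`r_N`, `a_N`, `D_N`, `P_N`) has remaining
`L²(dt)`-mass at most a fixed multiple of the ONE number `S_N(t₁)`. (v) Lead, `Theorems/…OneTimeEngine.lean`: **ONE-TIME ENGINE** —
`CoherentDephasing` (stmt-11810) BY NAME from `∃ η ∈ (0,1), N·S_N(N^η) → 0` (light cone inside the causal window, tail budget (iii)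
beyond it: `N∫₀^∞ r_N² ≤ N^{1+η}ε_N + (T/2γ)·N·S_N(N^η)`), the crux `↔ FouriersLaw` under that hypothesis, and `one-time ⇐ any α > 1
envelope` (`η = (α+1)/(2α)`): the weakest of the registered engine forms — no envelope, no rate, no integrability, one value of the
forecast norm per `N`. Kernel-checked restatements `engine_tailBudget`, `engine_leftSensitivity_tail`, `engine_commonPast_tail`,
`coherentDephasing_of_oneTime'`, `crux_iff_fouriersLaw_of_oneTime`, `oneTime_of_sq` at the end of this file (p149873, p150300 ACCEPTED). HONEST CENSUS: for THIS crux's composition the `P_N` term still needs the Hölder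
`θ`-tail (p137130) — `L²(dt)` tails do not give `L¹(dt)` tails on `(N^η, ∞)`; the one-time form is the exact requirement of the COHERENT
half. Both open stubs unchanged in kind (engine held; core ≡ FouriersLaw mod engine, p115953).

CONTINUATION LEAD c4, CYCLE 2 (2026-08-17): wave 2 = four workers + the lead's assembly, all ACCEPTED (`--supports`):
(vi) `Theorems/…ResamplePoincare.lean` (p140315) — the one-coordinate resampling Gaussian Poincaré inequality under `μ₀`
(`p_0` is an independent `N(0,T)`): `∫(f(z) − f(z̃))² d(μ₀⊗ν) ≤ (π²/4)T ∫(∂_{p_0}f)² dμ₀`; (vii) `Theorems/…LeftSensitivitySmooth.lean`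
(p141137) + `…LeftSensitivity.lean` (p141544) + `…LeftSensitivityAssembly.lean` (lead) — **the `N`-UNIFORM LEFT-SENSITIVITY BUDGET**
`∫₀^∞ D_N(s) ds ≤ π²T/(8γ)`, `D_N(s) = ∫(v_s(z) − v_s(z̃))² d(μ₀⊗ν)` (`z̃` = `z` with `p_0` resampled): the far forecast feels the
initial near-bath momentum only in an `L²(ds × μ₀⊗ν)`-budgeted way (resampling Poincaré × the `i = 0` tap of the time-resolved
dissipation inequality, then truncation `χ_k p_N → p_N`); `D_N` is the ONE functional that controls both cross terms of the line
(`lightCone_reduction`: `r_N² ≤ T·D_N`, `|P_N| ≤ K√D_N`), so (viii) `Theorems/…CommonPastBudget.lean` (p141111) + assembly: **the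
common-past term is `N`-uniformly square-integrable in time**, `∫₀^∞ P_N² ≤ K²π²T/(8γ)`; (ix) `Theorems/…GlobalFlip.lean` (p141353) —
**GLOBAL-FLIP PARITY**: the kernels commute with `Π(q,p) = (−q,−p)` (odd forces, symmetric noise: `transitionKernel_neg`), the
forecast is `Π`-ODD (`fcast_neg`) and hence `L²(μ₀)`-ORTHOGONAL TO EVERY `Π`-EVEN OBSERVABLE (`integral_even_mul_fcast`) — all energy
densities, the Hamiltonian, every conserved or hydrodynamic field of this chain: the forecast norm `S_N(t)` lives in the sector with
no slow mode, which is the structural reason the engine may hold with `N`-independent constants at `t ≫ N²`. HONEST CENSUS: (vii)–(viii)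
do not lower the exponent `α > 2` the crux composition asks of the engine for the `P_N` term (every route through `D_N`, Gaussian
IBP or detailed balance trades `t`-decay for a power of `N`; analysed, recorded in NOTES); the by-product `CoherentDephasing` stays at
`α > 1` (cycle 1). Wave 2b (two workers, one message): (x) `Theorems/…EnergyTimeReversal.lean` (p142604) — TIME REVERSAL OF
THE CRUX KERNEL ITSELF: `C_N(s+u) = ⟨(K_u e_0)∘Θ, K_s e_N⟩_{μ₀}` (`e_b = p_b² − T`) and **`|C_N(2t)| ≤ E_N(t)`**,
`E_N(t) = ‖K_t e_N‖²_{L²(μ₀)}` the ENERGY-forecast norm (Chapman–Kolmogorov + kernel detailed balance + left–right reflection,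
the `Π`-even twin of cycle 1's `r_N(2t)² ≤ S_N(t)²`): the crux's integrand is the `L²(μ₀)`-overlap of the two END ENERGY FORECASTS at
half time; (xi) `Theorems/…KineticAutocovTimeReversal.lean` (p142482) — the same for the near-bath kinetic autocovariance
`A_N(2t) = ⟨(K_t e_0)∘Θ, K_t e_0⟩`, `|A_N(2t)| ≤ E_N(t)` (`A_N` is the first integrand of the tree's sum rule `∫₀^∞(A_N + C_N) = T²/γ`,
`IncoherentBounded.sumRule`). Reading: the route's TWO cruxes are the two parity sectors of one mechanism — `CoherentDephasing` is the
decay of the MOMENTUM-forecast norm `S_N` (`Π`-odd, no conserved field, engine), `IncoherentChannel`/Fourier's law is the `1/N`-law of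
the time-integrated overlap of the ENERGY forecasts (`Π`-even, hydrodynamic; by the sum rule `(γ/T²)∫₀^∞ C_N = 1 − (γ/T²)∫₀^∞ A_N`, the
escape deficit of route `BoundaryEscapeDeficit`). Kernel-checked restatements `engine_leftSensitivityBudget`,
`engine_crossTerms_le_leftSensitivity`, `commonPast_sq_budget`, `fcast_parity`, `fcast_orthogonal_even` at the end of this file (the wave-2b
facts are kernel-checked in their own files `…EnergyTimeReversal`, `…KineticAutocovTimeReversal`; their restatements here wait for the farm build).

CONTINUATION LEAD c4 (prover-line-stmt-AtomisticToContinuum-11811-c4-0, 2026-08-17): skeleton taken over UNCHANGED (rc 0; sorries =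
`Holds.stub_forecastLoss`, `Holds.stub_varianceLimit`), re-registered under this seat; engine held; wave 1 = four workers on registered
structure helpers (all landed) + the lead's assembly. NEW THIS CYCLE (all ACCEPTED, `--supports`): the TIME-REVERSAL STRUCTURE of the
forecast, now affordable because kernel detailed balance `K_s* = ΘK_sΘ` on `L²(μ₀)` (`SubdiffusiveBondHeat.stub_kernelDetailedBalance`)
and kernel reflection covariance (`OddSectorWitness.transitionKernel_siteReflection`) are in tree: (i) `Theorems/…TimeReversal.lean`
(p138456) — Chapman–Kolmogorov for the forecast `v_{s+u} = K_s v_u` pointwise, the ECHO identity `a_N(s+u) = −⟨v_u∘Θ, v_s⟩_{μ₀}`,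
the coherent channel as the overlap of the two END forecasts `r_N(s+u) = −⟨v_u∘Θ, K_s p_0⟩_{μ₀}`, `|a_N(2t)| ≤ S_N(t)`,
`r_N(s+u)² ≤ S_N(u)·‖K_s p_0‖²`; (ii) `Theorems/…Reflection.lean` (p138752) — `‖K_s p_0‖²_{L²(μ₀)} = S_N(s)` (left–right symmetry of
the equal-temperature chain); (iii) `Theorems/…TimeReversalAssembly.lean` (p139625) — hence **`r_N(2t)² ≤ S_N(t)²`** for all `N ≥ 1`,
`t ≥ 0` (the fixed-`N` dictionary had only `r_N² ≤ T·S_N`): the route's Landauer channel is QUADRATICALLY small in the forecast norm;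
(iv) `Theorems/…SquareTail.lean` (p139163) + assembly — the composition re-run on (iii): the rank-2 by-product `CoherentDephasing`
(stmt-11810) BY NAME from a SQUARE-INTEGRABLE engine, `S_N ≤ C(1+t)^{−α}` with `α > 1` (registered engine: `α > 2`) or the square tail
`N∫_{t>N^η} S_N(t/2)² → 0`, and `IncoherentChannel ↔ FouriersLaw` already under that weaker engine; (v) `Theorems/…EchoStructure.lean`
(p139561) — the odd/even split under momentum reversal, `S_N(t) ± a_N(2t) = ½‖v_t ∓ v_t∘Θ‖²_{L²(μ₀)}` and `|a_N(t)| ≤ S_N(t/2)`: the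
engine kills both Θ-parts of the forecast, the echo only their difference. For THIS crux the common-past term `P_N = Cov(p_0², v_t²)`
keeps the Hölder exponent `θ < 1` (unbounded weight `p_0²`), so the crux composition still needs the `θ`-tail of p137130; the upgrade is
for the coherent half (kernel-checked restatements `engine_pairCorr_sq_le_fnorm_sq`, `engine_abs_echo_le`, `engine_oddEven_split`,
`coherentDephasing_of_sq`, `crux_iff_fouriersLaw_of_forecastLoss_sq` at the end of this file).

CONTINUATION LEAD c3 (prover-line-stmt-AtomisticToContinuum-11811-c3-0, 2026-08-17): skeleton taken over UNCHANGED (rc 0; sorries =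
`Holds.stub_forecastLoss`, `Holds.stub_varianceLimit`), re-registered under this seat; engine held; wave 1 = two workers on registered
engine-structure helpers (both landed). NEW THIS CYCLE (all ACCEPTED, `--supports`): (i) the TIME-RESOLVED FORECAST BUDGET
`S_N(t) + (2γ/T)∫₀ᵗ (r_N² + a_N²) ds ≤ T` for every `N` and `t ≥ 0` (`Theorems/…TimeResolvedBudget{Helper1,}.lean`, p136277/p136614:
the exact Bakry–Émery dissipation handle of the engine with the `‖K_t p_N‖²` term kept; it contains the c2 budget p135026 as `t → ∞`
and the leading contact loss); (ii) the matching N-UNIFORM LOWER short-time law `a_N(t) ≥ T − D·t`, `S_N(t) ≥ (T − D·t)²/T`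
(`Theorems/…Persistence.lean`, p136877), so the forecast norm obeys a TWO-SIDED `N`-uniform short-time law
(`engine_shortTime_twoSided` below); (iii) the CHANNEL BOOKKEEPING census (`Theorems/…ChannelBookkeeping.lean`, p135913):
`IncoherentChannel → ConductanceLowerBound` by name (the open item stmt-11749, wanted by five routes, is NECESSARY for this crux) and
`IncoherentChannel → (FouriersLaw ↔ the coherent channel N∫r_N² merely CONVERGES)` — given rank 3, what `closes` needs from rank 2 is
convergence of the Landauer channel, `CoherentDephasing` being the case of limit `0`.

CONTINUATION LEAD c2 (prover-line-stmt-AtomisticToContinuum-11811-c2-0, 2026-08-17): skeleton taken over UNCHANGED (rc 0; sorries =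
`Holds.stub_forecastLoss`, `Holds.stub_varianceLimit`), re-registered under this seat; engine held by the lead; no wave (the only
other open stub, `stub_varianceLimit`, is certified ≡ `FouriersLaw` modulo the engine, p115953). NEW THIS CYCLE (landed, `--supports`):
the N-UNIFORM CONTACT LOSS of the forecast norm — `Theorems/PhononMeanFreePathIncoherentChannelContactLoss{Helper1,Helper2,}.lean`
(p134499, p134634, p134710): `∃ D` independent of `N` with `S_N(t) ≤ T − t(√(2γT) − D√t)²` for `0 ≤ t`, `D√t ≤ √(2γT)`, hence
`∃ δ, t₀ > 0` independent of `N` with `S_N(t) ≤ (1−δ)T` for all `N`, `t ≥ t₀` (kernel-checked restatements `engine_contactLoss`,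
`engine_contactLoss_uniform` at the end of this file). The bound holds at `lam = β = 0` too: the engine's open content is exactly the
ESCAPED (bulk) fraction of the forecast. ALSO LANDED: the N-UNIFORM FORECAST BUDGET `∫₀^∞ (r_N² + a_N²) dt ≤ T²/(2γ)` for every `N`
(`Theorems/PhononMeanFreePathIncoherentChannelForecastBudget.lean`, p135026; restated as `engine_forecastBudget` below): the coherent
channel `r_N` and the echo `a_N = ⟨p_N, K_t p_N⟩` are jointly `L²(dt)`-bounded by the forecast budget, unconditionally — the integrated
counterpart of the pointwise envelopes the engine would give (Disproof §6.5).

CONTINUATION LEAD c1 (prover-line-stmt-AtomisticToContinuum-11811-c1-0, 2026-08-16T15:30Z): skeleton taken over UNCHANGED from the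
tree copy (rc 0; sorries = `Holds.stub_forecastLoss`, `Holds.stub_varianceLimit` only; `IncoherentChannel_of` concludes the crux by name),
re-registered under this seat; stub 1 held by the lead, stub 4′ delegated.

LEAD'S SKELETON rev 2 (prover-line-stmt-AtomisticToContinuum-11811-0, 2026-08-16): stubs 2 (`stub_lightCone`, p92940) and 3
(`stub_commonPastBound`, p89690) LANDED and imported; stub 4 reshaped to its limit clause `stub_varianceLimit` (fixed-N half
`varianceTransport_integrableOn` landed, p87312); vocabulary = landed `Theorems/PhononMeanFreePathDefs.lean` (p85310). Open: stub 1
(`stub_forecastLoss`, lead) and stub 4′ (`stub_varianceLimit`, transport core). `coherentDephasing_of` now needs stub 1 ONLY.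

REV 3 CENSUS (09:10–10:10Z, all LANDED in `Theorems/`): compositions `coherentDephasing_of_forecastLoss` (p93383),
`incoherentChannel_of_forecastLoss_of_varianceLimit` / `…_of_powerCovLimit`, `powerCovLimit_iff_varianceLimit_of_forecastLoss`
(p93654); structure `fnorm_antitone` (p93666); calibration `forecastLossEnvelope_false_harmonic` (p93738: stub 1 is FALSE at
`lam = β = 0`); and the UNCONDITIONAL route census `fouriersLaw_iff_kuboForm` (p93864): since `NessUnique_holds` and
`boundaryKubo_proof` (11812, closed 09:10Z) are theorems, `FouriersLaw ↔ ∀ params, ∃ κ > 0, N(γ²/T²)∫₀^∞ powerCov → κ`.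
Hence stub 4′ is, modulo stub 1, EQUIVALENT TO THE CONJUNCT — crux-sized by construction (→ `promote-stub`), and stub 1 alone
carries the route's rank-2 crux `CoherentDephasing`.

Skeleton (crux-plan, round 1) of crux idea card `Ideas/two-horizons-forecast-loss.md` (ideator 2; triage r1-1 / r1-2 /
r1-3: pass ×3, with sharpenings — all acted on, see the line card `Lines/two-horizons-forecast-loss.md`; the triagers'
merge proposal "two-horizons ≈ forgetting-before-hearing ≈ common-past-variance-carrier" is implemented: stubs 1–3 are
the common engine of the three cards, stub 4 is the companion card's C⁺). The crux is wanted by route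
`PhononMeanFreePath` only (rank 3); this file concludes it BY NAME (`IncoherentChannel_of`, `IncoherentChannel_proof`)
and, as a by-product from stubs 1–3 alone, the route's rank-2 crux `CoherentDephasing` (stmt-AtomisticToContinuum-11810)
BY NAME (`coherentDephasing_of`, `coherentDephasing_proof`).

THE LINE. Fix `ω₂, lam, β, γ > 0`, `T > 0`, `P = pinnedChain ω₂ lam β γ`, the `(N+1)`-site chain `0..N` with BOTH
Langevin baths at `T`; `μ₀ = P.gibbsMeasure (N+1) T`, `K_t = P.transitionKernel (N+1) T T t` (constructed in tree).
Objects (all `L²(μ₀)`-level, Gibbs-AVERAGED):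
  `v_t = K_t p_N`                                   (`fcast`, the MEAN FORECAST of the far momentum from the exact microstate),
  `S_N(t) = ‖v_t‖²_{L²(μ₀)}`                        (`fnorm`, the FORECAST NORM = two-noise-replica correlation `E[p_N^{(1)}p_N^{(2)}](t)`),
  `r_N(t) = ⟨p_0, v_t⟩_{μ₀}`                         (`pairCorr`, the route's `r_N`),
  `P_N(t) = Cov_{μ₀}(p_0², v_t²)`                    (`commonPast`, the COMMON-PAST part: Wick term `2r_N²` + fluctuation `A_N`),
  `C_N(t) = Cov_{μ₀}(p_0², K_t p_N²)`                (`powerCov`, VERBATIM the crux's kernel),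
  `B_N(t) = C_N − P_N = Cov_{μ₀}(p_0², Var(p_N(t)|z_0))` (`varianceChannel`, the companion card's carrier).
Exact law of total variance: `C_N − 2r_N² = B_N + (P_N − 2r_N²)` (the split is `ring` after unfolding).
* (STUB 1, ENGINE, HARDEST) `stub_forecastLoss`: `S_N(t) ≤ C(1+t)^{−α}` for some `α > 2`, ALL `N`, `t ≥ 0` — the
  thermostatted end momentum becomes unpredictable `N`-uniformly, integrably with a margin (predictability horizon
  `τ ≍ ℓ(lam·T)/v`, the phonon mean free path read on one boundary coordinate; kit j011153: `τ ≈ 30` at `lam·T = 1`).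
* (STUB 2) `stub_lightCone`: for every `η < 1`, `sup_{t ≤ N^η}(|P_N| + r_N²) ≤ ε_N` with `N^{1+η}ε_N → 0` — causality:
  nothing routed through the far forecast is correlated with `p_0²` before a signal can cross (`N^η ≪ N/c`).
* (STUB 3, fixed `N`) `stub_commonPastBound`: measurability in `t`; `r_N² ≤ T·S_N` (Cauchy–Schwarz); `|P_N| ≤ K_θ S_N^θ`
  for every `θ < 1` (Hölder + interpolation + `L^m(μ₀)`-contraction of `K_t`).
* (STUB 4, TRANSPORT CORE, shared) `stub_varianceTransport`: `B_N ∈ L¹`, `N(γ²/T²)∫₀^∞B_N → κ > 0`.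
* COMPOSITION (`meanChannels_of`, `cruxSeq_tendsto_of_split`, `IncoherentChannel_of`; sorry-free): with
  `θ = η = (α+2)/(2α)`, split `(0,∞)` at `N^η`: `N·|∫₀^∞(P_N − 2r_N²)| ≤ 2N^{1+η}ε_N + K⁺C^θ/(αθ−1)·N^{(2−α)/4} +
  2TC/(α−1)·N^{−(α−2)(α+1)/(2α)} → 0` (and the same for `N∫r_N²`), integrability at fixed `N` by domination; then
  `N(γ²/T²)∫(C_N − 2r_N²) = N(γ²/T²)∫B_N + (γ²/T²)·N∫(P_N − 2r_N²) → κ + 0`.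

WHAT IS HARD, HONESTLY. Stub 3 is fixed-`N` kernel theory (size M; true at `lam = β = 0`). Stub 2 is `N`-uniform but
SOFT (sub-ballistic window, super-polynomial smallness before arrival; true at the harmonic corner by the banded
propagator bound; for the quartic chain in Gibbs mean it is weaker than the almost-linear cone of ButtaMarchioro2016
Thm 2.2, unprinted for the open Langevin chain). Stub 1 is the line's BET and its new content: an `N`-uniform,
single-site, sum-of-squares decay statement for ONE S-odd observable of the OPEN equilibrium semigroup, with the exact
dissipation identity `dS_N/dt = −2γTΣ_b‖∂_{p_b}v_t‖²` and budget `T`; FALSE at `lam = β = 0` (plateau `≈ 0.15T` up to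
`t ≍ N/v`, kit j011153/j011196), consistent with `N`-uniform envelopes at `lam·T = β·T = 1` (n = 32, 64 curves coincide
within ±0.01 before the far-end cutoff and decay 0.20 → 0.05 over t = 5 … 45) but with the asymptotic LAW (exponential
τ ≈ 30 vs power) unsettled by MD — hence the polynomial form. Stub 4 is transport-strength (≡ Fourier's law for the
variance channel; under stubs 1–3 EQUIVALENT to the crux and to `D_{N+1} → κ`): the line does NOT make the hydrodynamic
core easier; it removes the SUBTRACTION `−2r_N²` and the common-past fluctuation WITHOUT CANCELLATION, identifies the
carrier (conditional variance, non-negative, positively sourced), and closes `CoherentDephasing` on the way.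

DISPROOF USED (`Cruxes/IncoherentChannel/Disproof.lean`, cdisprove gen 1 cycles 1–2, rc 0; landed as
`Theorems/IncoherentChannel/Negative/{LoadBearing, UnitTemperature, HarmonicFlow, KernelMoments, GibbsStein, HarmonicWick}`):
§2/§5 `crux_false_without_anharmonicity(_of_wick)`, `not_crux_at_harmonic` — HONOURED AND IMPORTED: `0 < lam`, `0 < β`
are hypotheses of every stub and are USED at stub 1 (forecast plateau at the corner) and stub 4 (`B_N ≡ 0`, Kalman);
stubs 2–3 hold at the corner; the calibration theorems `harmonic_corner_integrands_sum_zero` (from `harmonic_wick`: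
`B_N + (P_N − 2r_N²) ≡ 0` at `lam = β = 0`) and `harmonic_corner_not_both` (from `not_crux_at_harmonic`: the harmonic
analogues of stub 4 and of the mean-channel limit cannot both hold) are kernel-checked below. `crux_false_without_gammaPos`
— `γ > 0` enters stub 1 (`S_N ≡ T` at `γ = 0`) and stub 4 (prefactor); `crux_false_without_TPos` — `T > 0` enters stub 4
(prefactor, `μ₀ ≠ 0`); §4 `incoherentChannel_iff_unit_temperature` — all stubs are stated at every `T > 0` with
`T`-dependent constants (`C, α, ε, K, κ`), `S_N ↦ s²S_N` under the amplitude scaling, so a prover may work at `T = 1`;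
§3 `incoherentChannel_iff_fouriersLaw` — acknowledged: stub 4 carries the transport strength, by design; §1
`eventually_integrableOn_of_crux` — fixed-`N` integrability is explicit (stub 4 for `B_N`; derived for `P_N − 2r_N²`, `r_N²`).
No stub is an instance of a landed Negative lemma (all concern `lam = β = 0`, `γ = 0`, `T = 0` or the scaling);
negatives index (12 entries, 1 in FouriersLaw on `harmonicHostWithCell`): no overlap.

Shape (D-0027 §3.3, device of `Lines/contact_current_forgetting.lean`): each stub is a sorried theorem
`Holds.stub_<name> : <full statement> := by sorry` plus the by-name handle `def stub_<name> : Prop := type_of% Holds.stub_<name>`;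
`IncoherentChannel_of : stub_forecastLoss → stub_lightCone → stub_commonPastBound → stub_varianceTransport → IncoherentChannel`
concludes the crux BY NAME; `IncoherentChannel_proof` is the `<Crux>_proof` fed the four sorried stubs.
Namespace `Summit.AtomisticToContinuum.FouriersLaw.Cruxes.IncoherentChannel.TwoHorizonsForecastLoss`.
-/

noncomputable section

open MeasureTheory Set Filter Topology
open scoped NNReal

/-! ## Real-analysis toolkit (chain-independent) -/

namespace Summit.AtomisticToContinuum.FouriersLaw.Cruxes.IncoherentChannel.TwoHorizonsForecastLoss

/-- `(1+t)^{-s}` is integrable on `(0,∞)` for `s > 1`. [folklore] -/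
theorem integrableOn_one_add_rpow_neg {s : ℝ} (hs : 1 < s) :
    IntegrableOn (fun t : ℝ => (1 + t) ^ (-s)) (Ioi (0 : ℝ)) := by
  have h : Integrable (fun t : ℝ => (1 + ‖t‖) ^ (-s)) (volume : Measure ℝ) :=
    integrable_one_add_norm (E := ℝ) (μ := volume) (by simpa using hs)
  refine (h.integrableOn : IntegrableOn _ (Ioi (0 : ℝ))).congr_fun (fun t ht => ?_) measurableSet_Ioi
  simp only [Real.norm_of_nonneg (le_of_lt (show (0:ℝ) < t from ht))]

/-- Tail of the polynomial envelope: `∫_{(a,∞)} (1+t)^{-s} dt ≤ a^{1-s}/(s-1)` (`s > 1`, `a > 0`). [folklore] -/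
theorem setIntegral_Ioi_one_add_rpow_le {s a : ℝ} (hs : 1 < s) (ha : 0 < a) :
    ∫ t in Ioi a, (1 + t) ^ (-s) ≤ a ^ (1 - s) / (s - 1) := by
  have h1 : IntegrableOn (fun t : ℝ => (1 + t) ^ (-s)) (Ioi a) :=
    (integrableOn_one_add_rpow_neg hs).mono_set (Ioi_subset_Ioi ha.le)
  have h2 : IntegrableOn (fun t : ℝ => t ^ (-s)) (Ioi a) :=
    integrableOn_Ioi_rpow_of_lt (by linarith) ha
  calc ∫ t in Ioi a, (1 + t) ^ (-s) ≤ ∫ t in Ioi a, t ^ (-s) := by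
        refine setIntegral_mono_on h1 h2 measurableSet_Ioi (fun t ht => ?_)
        have ht : 0 < t := ha.trans ht
        exact Real.rpow_le_rpow_of_nonpos ht (by linarith) (by linarith)
    _ = a ^ (1 - s) / (s - 1) := by
        rw [integral_Ioi_rpow_of_lt (by linarith) ha, show -s + 1 = 1 - s by ring, neg_div, ← div_neg,
          neg_sub]

/-- TWO HORIZONS, abstractly: if `N`·(window level × window length) `→ 0` and `N`·(tail mass beyond the
window) `→ 0`, then `N · ∫_{(0,∞)} f_N → 0`. [folklore] -/
theorem tendsto_mul_integral_of_window_tail {f : ℕ → ℝ → ℝ} {a w b : ℕ → ℝ}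
    (ha : ∀ N, 0 ≤ a N) (hint : ∀ N, IntegrableOn (f N) (Ioi (0 : ℝ)))
    (hwin : ∀ (N : ℕ) (t : ℝ), 0 < t → t ≤ a N → |f N t| ≤ w N)
    (htail : ∀ᶠ N : ℕ in atTop, (N : ℝ) * ∫ t in Ioi (a N), |f N t| ≤ b N)
    (hw : Tendsto (fun N : ℕ => (N : ℝ) * (w N * a N)) atTop (𝓝 0))
    (hb : Tendsto b atTop (𝓝 0)) :
    Tendsto (fun N : ℕ => (N : ℝ) * ∫ t in Ioi (0 : ℝ), f N t) atTop (𝓝 0) := by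
  refine squeeze_zero_norm' ?_ (by simpa using hw.add hb)
  filter_upwards [htail] with N hN
  have hsplit : ∫ t in Ioi (0 : ℝ), f N t = (∫ t in Ioc 0 (a N), f N t) + ∫ t in Ioi (a N), f N t := by
    rw [← setIntegral_union Ioc_disjoint_Ioi_same measurableSet_Ioi
      ((hint N).mono_set Ioc_subset_Ioi_self) ((hint N).mono_set (Ioi_subset_Ioi (ha N))),
      Ioc_union_Ioi_eq_Ioi (ha N)]
  have hhead : ‖∫ t in Ioc 0 (a N), f N t‖ ≤ w N * a N := by
    have h := norm_setIntegral_le_of_norm_le_const (μ := (volume : Measure ℝ)) (f := f N)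
      (s := Ioc 0 (a N)) (C := w N) measure_Ioc_lt_top
      (fun t ht => by rw [Real.norm_eq_abs]; exact hwin N t ht.1 ht.2)
    rwa [Real.volume_real_Ioc_of_le (ha N), sub_zero] at h
  have htl : ‖∫ t in Ioi (a N), f N t‖ ≤ ∫ t in Ioi (a N), |f N t| := by
    have := norm_integral_le_integral_norm (μ := volume.restrict (Ioi (a N))) (f N)
    simpa only [Real.norm_eq_abs] using this
  have hN0 : (0 : ℝ) ≤ N := Nat.cast_nonneg N
  rw [norm_mul, Real.norm_natCast, hsplit]
  calc (N : ℝ) * ‖(∫ t in Ioc 0 (a N), f N t) + ∫ t in Ioi (a N), f N t‖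
      ≤ (N : ℝ) * (w N * a N + ∫ t in Ioi (a N), |f N t|) := by
        gcongr
        exact (norm_add_le _ _).trans (add_le_add hhead htl)
    _ = (N : ℝ) * (w N * a N) + (N : ℝ) * ∫ t in Ioi (a N), |f N t| := by ring
    _ ≤ (N : ℝ) * (w N * a N) + b N := by linarith

/-- Powers of `N` with a negative exponent tend to `0` along the naturals. [folklore] -/
theorem tendsto_natCast_rpow_of_neg {e : ℝ} (he : e < 0) :
    Tendsto (fun N : ℕ => (N : ℝ) ^ e) atTop (𝓝 0) := by
  have h1 := (tendsto_rpow_neg_atTop (show 0 < -e by linarith)).comp tendsto_natCast_atTop_atTop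
  refine h1.congr (fun N => ?_)
  simp [Function.comp_apply, neg_neg]


/-! ## Kernel-level objects of the `(N+1)`-site open chain `0..N` at equilibrium (both baths at `T`)

The vocabulary `fcast` (mean forecast `v_t = K_t p_N`), `fnorm` (`S_N = ‖v_t‖²_{L²(μ₀)}`), `pairCorr` (`r_N`),
`commonPast` (`P_N = Cov(p_0², v_t²)`), `powerCov` (`C_N`, VERBATIM the crux kernel) and `varianceChannel`
(`B_N = C_N − P_N`) is the LANDED route Defs file `Theorems/PhononMeanFreePathDefs.lean` (p85310), opened here. -/

open Literature.MathematicalPhysics.KineticTheory.HeatConduction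
open Summit.AtomisticToContinuum.FouriersLaw.Theses.PhononMeanFreePath (IncoherentChannel CoherentDephasing)
open Summit.AtomisticToContinuum.FouriersLaw.Theorems.PhononMeanFreePath

/-! ## Registered stubs (the lemmas of the line; `sorry` only here) -/

/-- **STUB 1 — `stub_forecastLoss` (the ENGINE: N-uniform loss of the end-momentum forecast; size XL; HARDEST).**
For all parameters `> 0` and `T > 0` there are `C` and `α > 2` with `S_N(t) = ‖K_t p_N‖²_{L²(μ₀)} ≤ C (1+t)^{−α}`
for ALL `N` and `t ≥ 0`: the thermostatted end momentum becomes unpredictable from exact initial data at an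
`N`-independent, integrable-with-margin rate (triage r1-1/2/3 sharpening: the polynomial form, not `Ce^{−t/τ}`).
FALSE at `lam = β = 0` (the escaped ballistic wave keeps a positive fraction of the forecast norm until it reaches the
far bath, `S_N` plateaus at `≈ 0.15·T` up to `t ≍ N/v`: kit j011153/j011196) — this is where `0 < lam`, `0 < β` are
USED; false at `γ = 0` (`S_N ≡ T`). Exact handle: `dS_N/dt = −2γT Σ_{b∈{0,N}} ‖∂_{p_b} K_t p_N‖²` (budget `T`). -/
theorem Holds.stub_forecastLoss :
    ∀ ω₂ lam β γ : ℝ, 0 < ω₂ → 0 < lam → 0 < β → 0 < γ → ∀ T : ℝ, 0 < T →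
      ∃ C α : ℝ, 2 < α ∧ ∀ (N : ℕ) (t : ℝ), 0 ≤ t →
        fnorm ω₂ lam β γ T N t ≤ C * (1 + t) ^ (-α) := by
  sorry

/-- **STUB 2 — `stub_lightCone` — LANDED** (p92940, `Theorems/PhononMeanFreePathIncoherentChannelLightCone.lean`,
with helpers 1–8 + Reduction): sub-ballistic causality window for the cross quantities — for every `η ∈ (0,1)` levels
`ε_N` with `N^{1+η}·ε_N → 0` and `|P_N(t)| + r_N(t)² ≤ ε_N` for `0 ≤ t ≤ N^η`. Proof: `p_0` is an independent
`N(0,T)` under `μ₀` (resampling reduction), then a Gibbs-mean finite speed of propagation for the constructed Langevin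
flow (lattice Grönwall with ONE scalar time-integrated rate, stationarity of both coupled copies, N-uniform Gibbs
moments of all orders). -/
theorem Holds.stub_lightCone :
    ∀ ω₂ lam β γ : ℝ, 0 < ω₂ → 0 < lam → 0 < β → 0 < γ → ∀ T : ℝ, 0 < T →
      ∀ η : ℝ, 0 < η → η < 1 → ∃ ε : ℕ → ℝ,
        Tendsto (fun N : ℕ => (N : ℝ) ^ (1 + η) * ε N) atTop (𝓝 0) ∧
        ∀ (N : ℕ) (t : ℝ), 0 ≤ t → t ≤ (N : ℝ) ^ η →
          |commonPast ω₂ lam β γ T N t| + (pairCorr ω₂ lam β γ T N t) ^ 2 ≤ ε N :=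
  Summit.AtomisticToContinuum.FouriersLaw.Theorems.PhononMeanFreePath.stub_lightCone

/-- **STUB 3 — `stub_commonPastBound` — LANDED** (p89690, `Theorems/PhononMeanFreePathIncoherentChannelCommonPastBound.lean`,
helpers 1–2): t-measurability of `P_N`, `r_N`; `r_N² ≤ T·S_N` (Cauchy–Schwarz); `|P_N| ≤ K(θ,T)·S_N^θ` for every
`θ < 1` with an explicit N-independent constant (Hölder + all even Gibbs momentum moments + kernel Jensen + Gibbs
invariance). -/
theorem Holds.stub_commonPastBound :
    ∀ ω₂ lam β γ : ℝ, 0 < ω₂ → 0 < lam → 0 < β → 0 < γ → ∀ T : ℝ, 0 < T →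
      (∀ N : ℕ, Measurable (commonPast ω₂ lam β γ T N) ∧ Measurable (pairCorr ω₂ lam β γ T N)) ∧
      (∀ (N : ℕ) (t : ℝ), 0 ≤ t → (pairCorr ω₂ lam β γ T N t) ^ 2 ≤ T * fnorm ω₂ lam β γ T N t) ∧
      ∀ θ : ℝ, 0 < θ → θ < 1 → ∃ K : ℝ, ∀ (N : ℕ) (t : ℝ), 0 ≤ t →
        |commonPast ω₂ lam β γ T N t| ≤ K * (fnorm ω₂ lam β γ T N t) ^ θ :=
  Summit.AtomisticToContinuum.FouriersLaw.Theorems.PhononMeanFreePath.stub_commonPastBound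

/-- **STUB 4′ — `stub_varianceLimit` (RESHAPED from `stub_varianceTransport`, whose fixed-`N` integrability conjunct
is LANDED: `varianceTransport_integrableOn`, p87312; THE TRANSPORT CORE; size open-problem).** For all parameters
`> 0` and `T > 0` there is `κ > 0` with `N(γ²/T²)∫₀^∞ B_N → κ`, `B_N(t) = Cov_{μ₀}(p_0², Var(p_N(t) | z_0))`
(carrier `w_t = K_t p_N² − v_t² ≥ 0`, `∫ w_t dμ₀ = T − S_N(t)`, `B_N = ∫ (p_0² − T) w_t dμ₀` — all landed,
`VarianceTransportHelper2`). Under the landed stubs 2–3 and stub 1 it is EQUIVALENT to the crux (Fourier's law for the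
variance channel ≡ `D_{N+1} → κ` by `BoundaryKubo`); FALSE at `lam = β = 0` (`B_N ≡ 0`) and at `γ = 0`. -/
theorem Holds.stub_varianceLimit :
    ∀ ω₂ lam β γ : ℝ, 0 < ω₂ → 0 < lam → 0 < β → 0 < γ → ∀ T : ℝ, 0 < T →
      ∃ κ : ℝ, 0 < κ ∧ Tendsto (fun N : ℕ => (N : ℝ) * (γ ^ 2 / T ^ 2) *
          ∫ t in Ioi (0 : ℝ), varianceChannel ω₂ lam β γ T N t) atTop (𝓝 κ) := by
  sorry

/-- **STUB 4 — `stub_varianceTransport` — DERIVED** from the reshaped stub 4′ and the landed fixed-`N` half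
(`varianceTransport_of_limit`, p87312). -/
theorem Holds.stub_varianceTransport :
    ∀ ω₂ lam β γ : ℝ, 0 < ω₂ → 0 < lam → 0 < β → 0 < γ → ∀ T : ℝ, 0 < T →
      ∃ κ : ℝ, 0 < κ ∧ (∀ N : ℕ, IntegrableOn (varianceChannel ω₂ lam β γ T N) (Ioi (0 : ℝ))) ∧
        Tendsto (fun N : ℕ => (N : ℝ) * (γ ^ 2 / T ^ 2) *
          ∫ t in Ioi (0 : ℝ), varianceChannel ω₂ lam β γ T N t) atTop (𝓝 κ) :=
  varianceTransport_of_limit Holds.stub_varianceLimit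

/-! ### By-name handles of the four statements (no second copy of the text) -/

/-- Statement of registered stub 1 (`Holds.stub_forecastLoss`), by name. -/
def stub_forecastLoss : Prop := type_of% Holds.stub_forecastLoss
/-- Statement of registered stub 2 (`Holds.stub_lightCone`), by name. -/
def stub_lightCone : Prop := type_of% Holds.stub_lightCone
/-- Statement of registered stub 3 (`Holds.stub_commonPastBound`), by name. -/
def stub_commonPastBound : Prop := type_of% Holds.stub_commonPastBound
/-- Statement of stub 4 (`Holds.stub_varianceTransport`, derived), by name. -/
def stub_varianceTransport : Prop := type_of% Holds.stub_varianceTransport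
/-- Statement of registered stub 4′ (`Holds.stub_varianceLimit`), by name. -/
def stub_varianceLimit : Prop := type_of% Holds.stub_varianceLimit

/-! ## Composition (sorry-free) -/

/-- **The two horizons close the mean channels.** From stubs 1–3 alone (no transport input): at every parameter
point, `t ↦ P_N − 2r_N²` and `t ↦ r_N²` are integrable on `(0,∞)` for every `N`, and
`N·∫₀^∞ (P_N − 2r_N²) → 0` (= `MeanChannelVanishes` up to the factor `γ²/T²`) and `N·∫₀^∞ r_N² → 0`
(= the conclusion of the route's rank-2 crux `CoherentDephasing`). Proof: with `θ = η = (α+2)/(2α) ∈ (0,1)`,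
split `(0,∞)` at the causal window `N^η`; inside, stub 2 (`≤ 2ε_N·N^η`); beyond, stubs 1+3 give the integrable
majorant `K⁺C^θ(1+t)^{−αθ} + 2TC(1+t)^{−α}` whose tail beyond `N^η`, times `N`, is
`≲ N^{(2−α)/4} + N^{−(α−2)(α+1)/(2α)} → 0`. [folklore] -/
theorem meanChannels_of (h₁ : stub_forecastLoss) (h₂ : stub_lightCone) (h₃ : stub_commonPastBound)
    {ω₂ lam β γ : ℝ} (hω : 0 < ω₂) (hl : 0 < lam) (hβ : 0 < β) (hγ : 0 < γ) {T : ℝ} (hT : 0 < T) :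
    (∀ N : ℕ, IntegrableOn (fun t => commonPast ω₂ lam β γ T N t - 2 * (pairCorr ω₂ lam β γ T N t) ^ 2)
        (Ioi (0 : ℝ))) ∧
    Tendsto (fun N : ℕ => (N : ℝ) * ∫ t in Ioi (0 : ℝ),
        (commonPast ω₂ lam β γ T N t - 2 * (pairCorr ω₂ lam β γ T N t) ^ 2)) atTop (𝓝 0) ∧
    (∀ N : ℕ, IntegrableOn (fun t => (pairCorr ω₂ lam β γ T N t) ^ 2) (Ioi (0 : ℝ))) ∧
    Tendsto (fun N : ℕ => (N : ℝ) * ∫ t in Ioi (0 : ℝ), (pairCorr ω₂ lam β γ T N t) ^ 2) atTop (𝓝 0) := by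
  -- the data of the three stubs
  obtain ⟨C, α, hα, hS⟩ := h₁ ω₂ lam β γ hω hl hβ hγ T hT
  obtain ⟨hmeas, hr2, hPθ⟩ := h₃ ω₂ lam β γ hω hl hβ hγ T hT
  -- the two exponents (equal): θ for the Hölder bound, η for the causal window
  set θ : ℝ := (α + 2) / (2 * α) with hθdef
  have hα0 : 0 < α := by linarith
  have hθ0 : 0 < θ := by rw [hθdef]; positivity
  have hθ1 : θ < 1 := by
    rw [hθdef, div_lt_one (by positivity)]; linarith
  have hαθ : α * θ = (α + 2) / 2 := by rw [hθdef]; field_simp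
  have hαθ1 : 1 < α * θ := by rw [hαθ]; linarith
  -- exponents of the two tail terms, both negative
  have he1 : 1 + θ * (1 - α * θ) = (2 - α) / 4 := by rw [hθdef]; field_simp; ring
  have he2 : 1 + θ * (1 - α) = -((α - 2) * (α + 1)) / (2 * α) := by rw [hθdef]; field_simp; ring
  have he1neg : 1 + θ * (1 - α * θ) < 0 := by
    rw [he1]; exact div_neg_of_neg_of_pos (by linarith) (by norm_num)
  have he2neg : 1 + θ * (1 - α) < 0 := by
    rw [he2]
    exact div_neg_of_neg_of_pos (neg_neg_of_pos (mul_pos (by linarith) (by linarith))) (by positivity)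
  obtain ⟨K, hK⟩ := hPθ θ hθ0 hθ1
  obtain ⟨ε, hε, hwin⟩ := h₂ ω₂ lam β γ hω hl hβ hγ T hT θ hθ0 hθ1
  -- abbreviations
  set S : ℕ → ℝ → ℝ := fun N t => fnorm ω₂ lam β γ T N t with hSdef
  set P : ℕ → ℝ → ℝ := fun N t => commonPast ω₂ lam β γ T N t with hPdef
  set r : ℕ → ℝ → ℝ := fun N t => pairCorr ω₂ lam β γ T N t with hrdef
  have hS0 : ∀ N t, 0 ≤ S N t := fun N t => fnorm_nonneg ω₂ lam β γ T N t
  -- C ≥ 0 (from `0 ≤ S_N(0) ≤ C`) and the clipped Hölder constant K⁺ = max K 0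
  have hC0 : 0 ≤ C := by
    have h := hS 0 0 le_rfl
    simp only [add_zero, Real.one_rpow, mul_one] at h
    exact (hS0 0 0).trans h
  set Kp : ℝ := max K 0 with hKpdef
  have hKp0 : 0 ≤ Kp := le_max_right _ _
  -- the envelope and the two majorants
  have h1t : ∀ t : ℝ, 0 ≤ t → 0 ≤ (1 + t) ^ (-α) := fun t ht => Real.rpow_nonneg (by linarith) _
  have hSθ : ∀ (N : ℕ) (t : ℝ), 0 ≤ t → S N t ^ θ ≤ C ^ θ * (1 + t) ^ (-(α * θ)) := by
    intro N t ht
    calc S N t ^ θ ≤ (C * (1 + t) ^ (-α)) ^ θ :=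
          Real.rpow_le_rpow (hS0 N t) (hS N t ht) hθ0.le
      _ = C ^ θ * (1 + t) ^ (-(α * θ)) := by
          rw [Real.mul_rpow hC0 (h1t t ht), ← Real.rpow_mul (by linarith : (0:ℝ) ≤ 1 + t), neg_mul]
  have hPbd : ∀ (N : ℕ) (t : ℝ), 0 ≤ t → |P N t| ≤ Kp * C ^ θ * (1 + t) ^ (-(α * θ)) := by
    intro N t ht
    calc |P N t| ≤ K * S N t ^ θ := hK N t ht
      _ ≤ Kp * S N t ^ θ := by
          gcongr
          · exact Real.rpow_nonneg (hS0 N t) θ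
          · exact le_max_left _ _
      _ ≤ Kp * (C ^ θ * (1 + t) ^ (-(α * θ))) := by gcongr; exact hSθ N t ht
      _ = Kp * C ^ θ * (1 + t) ^ (-(α * θ)) := by ring
  have hrbd : ∀ (N : ℕ) (t : ℝ), 0 ≤ t → (r N t) ^ 2 ≤ T * C * (1 + t) ^ (-α) := by
    intro N t ht
    calc (r N t) ^ 2 ≤ T * S N t := hr2 N t ht
      _ ≤ T * (C * (1 + t) ^ (-α)) := by gcongr; exact hS N t ht
      _ = T * C * (1 + t) ^ (-α) := by ring
  set G₁ : ℝ → ℝ := fun t => Kp * C ^ θ * (1 + t) ^ (-(α * θ)) with hG₁def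
  set G₂ : ℝ → ℝ := fun t => T * C * (1 + t) ^ (-α) with hG₂def
  have hG₁int : IntegrableOn G₁ (Ioi (0 : ℝ)) := (integrableOn_one_add_rpow_neg hαθ1).const_mul _
  have hG₂int : IntegrableOn G₂ (Ioi (0 : ℝ)) :=
    (integrableOn_one_add_rpow_neg (by linarith : (1:ℝ) < α)).const_mul _
  -- the mean-channel integrand f = P − 2r² and the coherent integrand g = r²
  set f : ℕ → ℝ → ℝ := fun N t => P N t - 2 * (r N t) ^ 2 with hfdef
  set g : ℕ → ℝ → ℝ := fun N t => (r N t) ^ 2 with hgdef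
  have hfmeas : ∀ N, Measurable (f N) := fun N =>
    (hmeas N).1.sub (((hmeas N).2.pow_const 2).const_mul 2)
  have hgmeas : ∀ N, Measurable (g N) := fun N => (hmeas N).2.pow_const 2
  have hfbd : ∀ (N : ℕ) (t : ℝ), 0 ≤ t → |f N t| ≤ G₁ t + 2 * G₂ t := by
    intro N t ht
    have h2 : (0:ℝ) ≤ 2 * (r N t) ^ 2 := by positivity
    calc |f N t| = |P N t - 2 * (r N t) ^ 2| := rfl
      _ ≤ |P N t| + |2 * (r N t) ^ 2| := abs_sub _ _
      _ = |P N t| + 2 * (r N t) ^ 2 := by rw [abs_of_nonneg h2]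
      _ ≤ G₁ t + 2 * G₂ t := by
          have := hPbd N t ht; have := hrbd N t ht
          simp only [hG₁def, hG₂def]; linarith
  have hgbd : ∀ (N : ℕ) (t : ℝ), 0 ≤ t → |g N t| ≤ G₂ t := by
    intro N t ht
    simp only [hgdef, abs_of_nonneg (sq_nonneg (r N t))]
    exact hrbd N t ht
  -- fixed-N integrability by domination
  have hfint : ∀ N, IntegrableOn (f N) (Ioi (0 : ℝ)) := by
    intro N
    refine Integrable.mono' (hG₁int.add (hG₂int.const_mul 2)) (hfmeas N).aestronglyMeasurable ?_
    refine (ae_restrict_iff' measurableSet_Ioi).2 (ae_of_all _ fun t (ht : 0 < t) => ?_)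
    rw [Real.norm_eq_abs]
    have := hfbd N t ht.le
    simpa [Pi.add_apply, mul_comm] using this
  have hgint : ∀ N, IntegrableOn (g N) (Ioi (0 : ℝ)) := by
    intro N
    refine Integrable.mono' hG₂int (hgmeas N).aestronglyMeasurable ?_
    refine (ae_restrict_iff' measurableSet_Ioi).2 (ae_of_all _ fun t (ht : 0 < t) => ?_)
    rw [Real.norm_eq_abs]
    exact hgbd N t ht.le
  -- the causal window a_N = N^θ
  set a : ℕ → ℝ := fun N => (N : ℝ) ^ θ with hadef
  have ha0 : ∀ N, 0 ≤ a N := fun N => Real.rpow_nonneg (Nat.cast_nonneg N) θ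
  have hapos : ∀ N : ℕ, 1 ≤ N → 0 < a N := fun N hN =>
    Real.rpow_pos_of_pos (by exact_mod_cast Nat.lt_of_lt_of_le Nat.zero_lt_one hN) θ
  -- tails of the two majorants beyond a > 0
  have htailG₁ : ∀ {x : ℝ}, 0 < x → IntegrableOn G₁ (Ioi x) ∧
      ∫ t in Ioi x, G₁ t ≤ Kp * C ^ θ * (x ^ (1 - α * θ) / (α * θ - 1)) := by
    intro x hx
    refine ⟨hG₁int.mono_set (Ioi_subset_Ioi hx.le), ?_⟩
    simp only [hG₁def]
    rw [integral_const_mul]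
    exact mul_le_mul_of_nonneg_left (setIntegral_Ioi_one_add_rpow_le hαθ1 hx) (by positivity)
  have htailG₂ : ∀ {x : ℝ}, 0 < x → IntegrableOn G₂ (Ioi x) ∧
      ∫ t in Ioi x, G₂ t ≤ T * C * (x ^ (1 - α) / (α - 1)) := by
    intro x hx
    refine ⟨hG₂int.mono_set (Ioi_subset_Ioi hx.le), ?_⟩
    simp only [hG₂def]
    rw [integral_const_mul]
    exact mul_le_mul_of_nonneg_left (setIntegral_Ioi_one_add_rpow_le (by linarith) hx) (by positivity)
  -- exponent bookkeeping: N · (N^θ)^(1-s) = N^(1 + θ(1-s))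
  have hpow : ∀ (N : ℕ), 1 ≤ N → ∀ s : ℝ, (N : ℝ) * (a N) ^ (1 - s) = (N : ℝ) ^ (1 + θ * (1 - s)) := by
    intro N hN s
    have hNpos : (0 : ℝ) < N := by exact_mod_cast Nat.lt_of_lt_of_le Nat.zero_lt_one hN
    simp only [hadef]
    rw [← Real.rpow_mul hNpos.le, Real.rpow_add hNpos, Real.rpow_one]
  -- the two tail sequences
  set b₂ : ℕ → ℝ := fun N => T * C / (α - 1) * (N : ℝ) ^ (1 + θ * (1 - α)) with hb₂def
  set b₁ : ℕ → ℝ := fun N => Kp * C ^ θ / (α * θ - 1) * (N : ℝ) ^ (1 + θ * (1 - α * θ)) + 2 * b₂ N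
    with hb₁def
  have hb₂lim : Tendsto b₂ atTop (𝓝 0) := by
    have := (tendsto_natCast_rpow_of_neg he2neg).const_mul (T * C / (α - 1))
    simpa [hb₂def] using this
  have hb₁lim : Tendsto b₁ atTop (𝓝 0) := by
    have h1 := (tendsto_natCast_rpow_of_neg he1neg).const_mul (Kp * C ^ θ / (α * θ - 1))
    have := h1.add (hb₂lim.const_mul 2)
    simpa [hb₁def] using this
  -- tail estimates for N ≥ 1
  have htailg : ∀ᶠ N : ℕ in atTop, (N : ℝ) * ∫ t in Ioi (a N), |g N t| ≤ b₂ N := by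
    filter_upwards [eventually_ge_atTop 1] with N hN
    have hx := hapos N hN
    obtain ⟨hG₂x, hG₂le⟩ := htailG₂ hx
    have hle : ∫ t in Ioi (a N), |g N t| ≤ ∫ t in Ioi (a N), G₂ t :=
      setIntegral_mono_on ((hgint N).mono_set (Ioi_subset_Ioi (ha0 N))).abs hG₂x measurableSet_Ioi
        (fun t ht => hgbd N t ((ha0 N).trans (le_of_lt ht)))
    have hN0 : (0 : ℝ) ≤ N := Nat.cast_nonneg N
    calc (N : ℝ) * ∫ t in Ioi (a N), |g N t| ≤ (N : ℝ) * (T * C * ((a N) ^ (1 - α) / (α - 1))) := by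
          exact mul_le_mul_of_nonneg_left (hle.trans hG₂le) hN0
      _ = T * C / (α - 1) * ((N : ℝ) * (a N) ^ (1 - α)) := by ring
      _ = b₂ N := by rw [hpow N hN α]
  have htailf : ∀ᶠ N : ℕ in atTop, (N : ℝ) * ∫ t in Ioi (a N), |f N t| ≤ b₁ N := by
    filter_upwards [eventually_ge_atTop 1] with N hN
    have hx := hapos N hN
    obtain ⟨hG₁x, hG₁le⟩ := htailG₁ hx
    obtain ⟨hG₂x, hG₂le⟩ := htailG₂ hx
    have hle : ∫ t in Ioi (a N), |f N t| ≤ ∫ t in Ioi (a N), (G₁ t + 2 * G₂ t) :=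
      setIntegral_mono_on ((hfint N).mono_set (Ioi_subset_Ioi (ha0 N))).abs (hG₁x.add (hG₂x.const_mul 2))
        measurableSet_Ioi (fun t ht => hfbd N t ((ha0 N).trans (le_of_lt ht)))
    have hsum : ∫ t in Ioi (a N), (G₁ t + 2 * G₂ t) = (∫ t in Ioi (a N), G₁ t) + 2 * ∫ t in Ioi (a N), G₂ t := by
      rw [integral_add hG₁x (hG₂x.const_mul 2), integral_const_mul (2:ℝ) G₂]
    have hN0 : (0 : ℝ) ≤ N := Nat.cast_nonneg N
    calc (N : ℝ) * ∫ t in Ioi (a N), |f N t|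
        ≤ (N : ℝ) * (Kp * C ^ θ * ((a N) ^ (1 - α * θ) / (α * θ - 1)) +
            2 * (T * C * ((a N) ^ (1 - α) / (α - 1)))) := by
          refine mul_le_mul_of_nonneg_left ?_ hN0
          rw [hsum] at hle
          linarith
      _ = Kp * C ^ θ / (α * θ - 1) * ((N : ℝ) * (a N) ^ (1 - α * θ)) +
            2 * (T * C / (α - 1) * ((N : ℝ) * (a N) ^ (1 - α))) := by ring
      _ = b₁ N := by rw [hpow N hN (α * θ), hpow N hN α]
  -- window bounds (stub 2): |f| ≤ 2ε_N and |g| ≤ ε_N on (0, N^θ]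
  have hwinf : ∀ (N : ℕ) (t : ℝ), 0 < t → t ≤ a N → |f N t| ≤ 2 * ε N := by
    intro N t ht hta
    have hw := hwin N t ht.le hta
    have h2 : (0:ℝ) ≤ 2 * (r N t) ^ 2 := by positivity
    calc |f N t| ≤ |P N t| + |2 * (r N t) ^ 2| := abs_sub _ _
      _ = |P N t| + 2 * (r N t) ^ 2 := by rw [abs_of_nonneg h2]
      _ ≤ 2 * (|P N t| + (r N t) ^ 2) := by linarith [abs_nonneg (P N t)]
      _ ≤ 2 * ε N := by linarith
  have hwing : ∀ (N : ℕ) (t : ℝ), 0 < t → t ≤ a N → |g N t| ≤ ε N := by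
    intro N t ht hta
    have hw := hwin N t ht.le hta
    simp only [hgdef, abs_of_nonneg (sq_nonneg (r N t))]
    linarith [abs_nonneg (P N t)]
  -- window masses: N · (level × length) → 0
  have hNa : ∀ N : ℕ, (N : ℝ) * a N = (N : ℝ) ^ (1 + θ) := by
    intro N
    simp only [hadef]
    rw [Real.rpow_add' (Nat.cast_nonneg N) (by linarith : (1:ℝ) + θ ≠ 0), Real.rpow_one]
  have hwf : Tendsto (fun N : ℕ => (N : ℝ) * (2 * ε N * a N)) atTop (𝓝 0) := by
    have := hε.const_mul 2
    rw [mul_zero] at this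
    refine this.congr (fun N => ?_)
    rw [← hNa N]; ring
  have hwg : Tendsto (fun N : ℕ => (N : ℝ) * (ε N * a N)) atTop (𝓝 0) := by
    refine hε.congr (fun N => ?_)
    rw [← hNa N]; ring
  -- assemble with the abstract two-horizons lemma
  refine ⟨hfint, ?_, hgint, ?_⟩
  · exact tendsto_mul_integral_of_window_tail ha0 hfint hwinf htailf hwf hb₁lim
  · exact tendsto_mul_integral_of_window_tail ha0 hgint hwing htailg hwg hb₂lim

/-- **BY-PRODUCT: the line closes the route's rank-2 crux `CoherentDephasing` (stmt-AtomisticToContinuum-11810) BY NAME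
from stubs 1–3 alone** (`2r_N² ≤ 2T·S_N`: the coherent Landauer channel is slaved to the forecast norm). [folklore] -/
theorem coherentDephasing_of (h₁ : stub_forecastLoss) (h₂ : stub_lightCone) (h₃ : stub_commonPastBound) :
    CoherentDephasing := by
  intro ω₂ lam β γ hω hl hβ hγ T hT
  obtain ⟨-, -, hrint, hrlim⟩ := meanChannels_of h₁ h₂ h₃ hω hl hβ hγ hT
  exact ⟨hrint, hrlim⟩

/-- CHANNEL SPLIT (pure algebra + `integral_add`): pointwise `C_N − 2r_N² = B_N + (P_N − 2r_N²)` by definitional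
unfolding and `ring`; hence if `N(γ²/T²)∫B_N → κ` and `N∫(P_N − 2r_N²) → 0` (both integrands integrable at each
`N`), the crux's own sequence — written VERBATIM as in the route decl — tends to `κ`. Stated for all real
parameters (used at `lam, β > 0` by `IncoherentChannel_of` and at the harmonic corner by the calibration). [folklore] -/
theorem cruxSeq_tendsto_of_split {ω₂ lam β γ T κ : ℝ}
    (hBint : ∀ N : ℕ, IntegrableOn (varianceChannel ω₂ lam β γ T N) (Ioi (0 : ℝ)))
    (hBlim : Tendsto (fun N : ℕ => (N : ℝ) * (γ ^ 2 / T ^ 2) *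
      ∫ t in Ioi (0 : ℝ), varianceChannel ω₂ lam β γ T N t) atTop (𝓝 κ))
    (hMint : ∀ N : ℕ, IntegrableOn
      (fun t => commonPast ω₂ lam β γ T N t - 2 * (pairCorr ω₂ lam β γ T N t) ^ 2) (Ioi (0 : ℝ)))
    (hMlim : Tendsto (fun N : ℕ => (N : ℝ) * ∫ t in Ioi (0 : ℝ),
      (commonPast ω₂ lam β γ T N t - 2 * (pairCorr ω₂ lam β γ T N t) ^ 2)) atTop (𝓝 0)) :
    Filter.Tendsto (fun N : ℕ => (N : ℝ) * (γ ^ 2 / T ^ 2) * ∫ t in Set.Ioi (0 : ℝ),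
      ((∫ z, (z.2 0) ^ 2 * (∫ y, (y.2 (Fin.last N)) ^ 2 ∂((pinnedChain ω₂ lam β γ).transitionKernel (N + 1) T T t.toNNReal z)) ∂((pinnedChain ω₂ lam β γ).gibbsMeasure (N + 1) T)) -
        (∫ z, (z.2 0) ^ 2 ∂((pinnedChain ω₂ lam β γ).gibbsMeasure (N + 1) T)) *
          (∫ z, (∫ y, (y.2 (Fin.last N)) ^ 2 ∂((pinnedChain ω₂ lam β γ).transitionKernel (N + 1) T T t.toNNReal z)) ∂((pinnedChain ω₂ lam β γ).gibbsMeasure (N + 1) T)) -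
        2 * (∫ z, z.2 0 * (∫ y, y.2 (Fin.last N) ∂((pinnedChain ω₂ lam β γ).transitionKernel (N + 1) T T t.toNNReal z)) ∂((pinnedChain ω₂ lam β γ).gibbsMeasure (N + 1) T)) ^ 2))
      Filter.atTop (nhds κ) := by
  have key : ∀ N : ℕ,
      (N : ℝ) * (γ ^ 2 / T ^ 2) * ∫ t in Set.Ioi (0:ℝ),
        ((∫ z, (z.2 0) ^ 2 * (∫ y, (y.2 (Fin.last N)) ^ 2 ∂((pinnedChain ω₂ lam β γ).transitionKernel (N + 1) T T t.toNNReal z)) ∂((pinnedChain ω₂ lam β γ).gibbsMeasure (N + 1) T)) -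
          (∫ z, (z.2 0) ^ 2 ∂((pinnedChain ω₂ lam β γ).gibbsMeasure (N + 1) T)) *
            (∫ z, (∫ y, (y.2 (Fin.last N)) ^ 2 ∂((pinnedChain ω₂ lam β γ).transitionKernel (N + 1) T T t.toNNReal z)) ∂((pinnedChain ω₂ lam β γ).gibbsMeasure (N + 1) T)) -
          2 * (∫ z, z.2 0 * (∫ y, y.2 (Fin.last N) ∂((pinnedChain ω₂ lam β γ).transitionKernel (N + 1) T T t.toNNReal z)) ∂((pinnedChain ω₂ lam β γ).gibbsMeasure (N + 1) T)) ^ 2)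
      = (N : ℝ) * (γ ^ 2 / T ^ 2) * (∫ t in Set.Ioi (0:ℝ), varianceChannel ω₂ lam β γ T N t) +
        (γ ^ 2 / T ^ 2) * ((N : ℝ) * ∫ t in Set.Ioi (0:ℝ),
          (commonPast ω₂ lam β γ T N t - 2 * (pairCorr ω₂ lam β γ T N t) ^ 2)) := by
    intro N
    rw [show (γ ^ 2 / T ^ 2) * ((N : ℝ) * ∫ t in Set.Ioi (0:ℝ),
          (commonPast ω₂ lam β γ T N t - 2 * (pairCorr ω₂ lam β γ T N t) ^ 2)) =
        (N : ℝ) * (γ ^ 2 / T ^ 2) * ∫ t in Set.Ioi (0:ℝ),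
          (commonPast ω₂ lam β γ T N t - 2 * (pairCorr ω₂ lam β γ T N t) ^ 2) by ring,
      ← mul_add, ← integral_add (hBint N) (hMint N)]
    congr 1
    refine setIntegral_congr_fun measurableSet_Ioi (fun t _ => ?_)
    simp only [varianceChannel, powerCov, commonPast, pairCorr, fcast]
    ring
  simp_rw [key]
  simpa using hBlim.add (hMlim.const_mul (γ ^ 2 / T ^ 2))

/-- **`IncoherentChannel_of` — the skeleton concludes the crux BY NAME** (`PhononMeanFreePath.IncoherentChannel`,
stmt-AtomisticToContinuum-11811) from the four registered stubs: `κ` and the variance channel from stub 4, the mean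
channel from `meanChannels_of` (stubs 1–3), assembled by `cruxSeq_tendsto_of_split`. [folklore] -/
theorem IncoherentChannel_of (h₁ : stub_forecastLoss) (h₂ : stub_lightCone) (h₃ : stub_commonPastBound)
    (h₄ : stub_varianceTransport) : IncoherentChannel := by
  intro ω₂ lam β γ hω hl hβ hγ T hT
  obtain ⟨κ, hκ, hBint, hBlim⟩ := h₄ ω₂ lam β γ hω hl hβ hγ T hT
  obtain ⟨hMint, hMlim, -, -⟩ := meanChannels_of h₁ h₂ h₃ hω hl hβ hγ hT
  exact ⟨κ, hκ, cruxSeq_tendsto_of_split hBint hBlim hMint hMlim⟩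

/-! ## Calibration at the harmonic corner (landed Negative lemmas, imported) -/

/-- At `lam = β = 0` the two integrands of the composition sum to the cumulant kernel, which VANISHES IDENTICALLY by
the landed Negative lemma `HarmonicWick.harmonic_wick` (p77793): `B_N + (P_N − 2r_N²) = C_N − 2r_N² ≡ 0`. [folklore] -/
theorem harmonic_corner_integrands_sum_zero {ω₂ γ T : ℝ} (hω : 0 < ω₂) (hγ : 0 ≤ γ) (hT : 0 < T)
    (N : ℕ) (t : ℝ) :
    varianceChannel ω₂ 0 0 γ T N t + (commonPast ω₂ 0 0 γ T N t - 2 * (pairCorr ω₂ 0 0 γ T N t) ^ 2) = 0 := by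
  have h := Summit.AtomisticToContinuum.FouriersLaw.Theorems.IncoherentChannel.Negative.HarmonicWick.harmonic_wick
    hω hγ hT N t
  have e : varianceChannel ω₂ 0 0 γ T N t + (commonPast ω₂ 0 0 γ T N t - 2 * (pairCorr ω₂ 0 0 γ T N t) ^ 2) =
      powerCov ω₂ 0 0 γ T N t - 2 * (pairCorr ω₂ 0 0 γ T N t) ^ 2 := by
    simp only [varianceChannel]; ring
  rw [e, sub_eq_zero]
  exact h

/-- **Where the line uses `0 < lam ∧ 0 < β`** (honouring `LoadBearing.crux_false_without_anharmonicity_of_wick` /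
`HarmonicWick.crux_false_without_anharmonicity`): at the harmonic corner the conclusions of STUB 4 (variance
transport with `κ > 0`) and of `meanChannels_of` (mean channel `o(1/N)`) CANNOT both hold — by the channel split
they would certify the harmonic crux, refuted by the landed lemma `HarmonicWick.not_crux_at_harmonic`. In the line,
`stub_varianceTransport` is false there (`B_N ≡ 0`, Kalman) and so is `stub_forecastLoss` (forecast plateau), while
`stub_lightCone` and `stub_commonPastBound` hold at the corner. [folklore] -/
theorem harmonic_corner_not_both {ω₂ γ T : ℝ} (hω : 0 < ω₂) (hγ : 0 < γ) (hT : 0 < T) :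
    ¬ ((∃ κ : ℝ, 0 < κ ∧ (∀ N : ℕ, IntegrableOn (varianceChannel ω₂ 0 0 γ T N) (Ioi (0 : ℝ))) ∧
          Tendsto (fun N : ℕ => (N : ℝ) * (γ ^ 2 / T ^ 2) *
            ∫ t in Ioi (0 : ℝ), varianceChannel ω₂ 0 0 γ T N t) atTop (𝓝 κ)) ∧
       ((∀ N : ℕ, IntegrableOn
            (fun t => commonPast ω₂ 0 0 γ T N t - 2 * (pairCorr ω₂ 0 0 γ T N t) ^ 2) (Ioi (0 : ℝ))) ∧
          Tendsto (fun N : ℕ => (N : ℝ) * ∫ t in Ioi (0 : ℝ),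
            (commonPast ω₂ 0 0 γ T N t - 2 * (pairCorr ω₂ 0 0 γ T N t) ^ 2)) atTop (𝓝 0))) := by
  rintro ⟨⟨κ, hκ, hBint, hBlim⟩, hMint, hMlim⟩
  exact Summit.AtomisticToContinuum.FouriersLaw.Theorems.IncoherentChannel.Negative.HarmonicWick.not_crux_at_harmonic
    hω hγ.le hT ⟨κ, hκ, cruxSeq_tendsto_of_split hBint hBlim hMint hMlim⟩

/-- D-0027 §3.3 shape: **`IncoherentChannel_proof`** — the crux (by name) from the four REGISTERED stubs; it depends
on `sorryAx` exactly through `Holds.stub_*` and becomes a proof once the four `sorry`s are discharged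
(`IncoherentChannel_of` stays the sorry-free composition). -/
theorem IncoherentChannel_proof : IncoherentChannel :=
  IncoherentChannel_of Holds.stub_forecastLoss Holds.stub_lightCone Holds.stub_commonPastBound
    Holds.stub_varianceTransport

/-- Same shape for the by-product: `CoherentDephasing` from the three registered stubs 1–3. -/
theorem coherentDephasing_proof : CoherentDephasing :=
  coherentDephasing_of Holds.stub_forecastLoss Holds.stub_lightCone Holds.stub_commonPastBound

/-! ## Line census (lead c1, 2026-08-16): what the two OPEN stubs are worth — kernel-checked against landed certificates

* `stub_varianceLimit_iff_fouriersLaw_of_stub1`: GIVEN stub 1 (the engine), the registered transport-core stub 4′ is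
  EQUIVALENT to the sub-problem conjunct `FouriersLaw` (landed `varianceLimit_iff_fouriersLaw_of_forecastLoss`, p115953,
  `Theorems/PhononMeanFreePathIncoherentChannelVarianceLimitReduction.lean`) — stub 4′ is conjunct-sized BY THEOREM.
* `incoherentChannel_iff_fouriersLaw_of_stub1`: GIVEN stub 1 alone, the CRUX is equivalent to the conjunct (landed
  `incoherentChannel_iff_fouriersLaw_of_forecastLoss`, p115514, `…LineCensus.lean`: engine ⇒ `CoherentDephasing`, then
  `Negative.LoadBearing.incoherentChannel_iff_fouriersLaw` over the proved siblings `NessUnique_holds`, `boundaryKubo_proof`).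
So the line's residual is exactly: ENGINE (N-uniform forecast loss; closes 11810 by itself) + Fourier's law for this chain. -/

/-- Given stub 1, stub 4′ `↔ FouriersLaw` (certificate p115953). [folklore] -/
theorem stub_varianceLimit_iff_fouriersLaw_of_stub1 (h₁ : stub_forecastLoss) :
    stub_varianceLimit ↔ _root_.FouriersLaw :=
  varianceLimit_iff_fouriersLaw_of_forecastLoss h₁

/-- Given stub 1 alone, the crux `↔ FouriersLaw` (certificate p115514). [folklore] -/
theorem incoherentChannel_iff_fouriersLaw_of_stub1 (h₁ : stub_forecastLoss) :
    IncoherentChannel ↔ _root_.FouriersLaw :=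
  incoherentChannel_iff_fouriersLaw_of_forecastLoss h₁

/-! ## Line census (lead c2, 2026-08-17): the CONTACT part of the engine is a theorem, uniformly in `N`

The engine `stub_forecastLoss` asks for `S_N(t) → 0` `N`-uniformly (integrably with margin). Its contact part is now PROVED
(`Theorems/PhononMeanFreePathIncoherentChannelContactLoss.lean`, p134710; helpers p134499, p134634): on `μ₀ ⊗ W` the
unpredictable part `p_N(t) − v_t` projects on the right bath's own Brownian increment with coefficient `√(2γT)t + O(t^{3/2})`
uniformly in `N` (pathwise SDE of `p_N`, stationarity `(μ₀ ⊗ W).map Φ_r = μ₀`, `N`-uniform Gibbs moments of the bath-site drift,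
Cauchy–Schwarz). What it leaves open is the ESCAPED fraction (the harmonic plateau): projecting on earlier noise needs the response
`E[D_s p_N(t)] = √(2γT) R_N(t−s)`, whose `N`-uniform decay is the engine itself. -/

/-- **Contact loss, `N`-uniform** (p134710): `∃ D ≥ 0` independent of `N` with `S_N(t) ≤ T − t (√(2γT) − D√t)²` whenever
`0 ≤ t` and `D√t ≤ √(2γT)` — in particular `S_N(t) ≤ T − 2γT·t + O(t^{3/2})` uniformly in `N`. [folklore] -/
theorem engine_contactLoss : ∀ ω₂ lam β γ : ℝ, 0 < ω₂ → 0 ≤ lam → 0 ≤ β → 0 ≤ γ → ∀ T : ℝ, 0 < T →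
    ∃ D : ℝ, 0 ≤ D ∧ ∀ (N : ℕ) (t : ℝ), 0 ≤ t → Real.sqrt t * D ≤ Real.sqrt (2 * γ * T) →
      fnorm ω₂ lam β γ T N t ≤ T - t * (Real.sqrt (2 * γ * T) - Real.sqrt t * D) ^ 2 :=
  contactLoss_fnorm_le

/-- **The `N`-uniform forecast budget** (p135026): `∫₀^∞ (r_N(t)² + a_N(t)²) dt ≤ T²/(2γ)` for every `N` — the route's
coherent channel `r_N = pairCorr` and the echo `a_N = ⟨p_N, K_t p_N⟩_{μ₀}` written out as in the route file. [folklore] -/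
theorem engine_forecastBudget : ∀ ω₂ lam β γ : ℝ, 0 < ω₂ → 0 ≤ lam → 0 < β → 0 < γ → ∀ T : ℝ, 0 < T → ∀ N : ℕ,
    ∫ t in Ioi (0 : ℝ), ((∫ z, z.2 0 * (∫ y, y.2 (Fin.last N)
        ∂((pinnedChain ω₂ lam β γ).transitionKernel (N + 1) T T t.toNNReal z))
        ∂((pinnedChain ω₂ lam β γ).gibbsMeasure (N + 1) T)) ^ 2 +
      (∫ z, z.2 (Fin.last N) * (∫ y, y.2 (Fin.last N)
        ∂((pinnedChain ω₂ lam β γ).transitionKernel (N + 1) T T t.toNNReal z))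
        ∂((pinnedChain ω₂ lam β γ).gibbsMeasure (N + 1) T)) ^ 2) ≤ T ^ 2 / (2 * γ) :=
  forecastBudget

/-- The budget bounds the line's coherent channel in its own vocabulary: `∫₀^∞ pairCorr² ≤ T²/(2γ)` for every `N`
(drop the echo; `pairCorr` unfolds to the route's `r_N`). [folklore] -/
theorem pairCorr_sq_integral_le {ω₂ lam β γ T : ℝ} (hω : 0 < ω₂) (hl : 0 ≤ lam) (hβ : 0 < β) (hγ : 0 < γ)
    (hT : 0 < T) (N : ℕ) :
    ∫ t in Ioi (0 : ℝ), (pairCorr ω₂ lam β γ T N t) ^ 2 ≤ T ^ 2 / (2 * γ) := by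
  have hb := engine_forecastBudget ω₂ lam β γ hω hl hβ hγ T hT N
  have hr := Summit.AtomisticToContinuum.FouriersLaw.Theorems.IncoherentBounded.rN_sq_integrableOn hω hl hβ hγ hT N
  have ha := aN_sq_integrableOn hω hl hβ hγ hT N
  have hsplit := integral_add hr ha
  rw [hsplit] at hb
  have ha0 : 0 ≤ ∫ t in Ioi (0 : ℝ), (∫ z, z.2 (Fin.last N) * (∫ y, y.2 (Fin.last N)
      ∂((pinnedChain ω₂ lam β γ).transitionKernel (N + 1) T T t.toNNReal z))
      ∂((pinnedChain ω₂ lam β γ).gibbsMeasure (N + 1) T)) ^ 2 := integral_nonneg fun t => sq_nonneg _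
  have e : ∀ t, (pairCorr ω₂ lam β γ T N t) ^ 2 = (∫ z, z.2 0 * (∫ y, y.2 (Fin.last N)
      ∂((pinnedChain ω₂ lam β γ).transitionKernel (N + 1) T T t.toNNReal z))
      ∂((pinnedChain ω₂ lam β γ).gibbsMeasure (N + 1) T)) ^ 2 := fun t => rfl
  simp_rw [e]
  linarith

/-- **A fixed fraction of the forecast norm is lost in a time of order one, uniformly in `N`** (p134710):
`∃ δ, t₀ > 0` independent of `N` with `S_N(t) ≤ (1 − δ)T` for every `N` and every `t ≥ t₀`. [folklore] -/
theorem engine_contactLoss_uniform : ∀ ω₂ lam β γ : ℝ, 0 < ω₂ → 0 < lam → 0 < β → 0 < γ → ∀ T : ℝ, 0 < T →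
    ∃ δ t₀ : ℝ, 0 < δ ∧ 0 < t₀ ∧ ∀ (N : ℕ) (t : ℝ), t₀ ≤ t → fnorm ω₂ lam β γ T N t ≤ (1 - δ) * T :=
  contactLoss_fnorm_le_uniform

/-! ## Line census (lead c3, 2026-08-17): the exact dissipation handle, a two-sided short-time law, and what the crux forces

* `engine_timeResolvedBudget` (p136614): `S_N(t) + (2γ/T)∫₀ᵗ (r_N² + a_N²) ds ≤ T` for every `N`, `t ≥ 0` — the integrated
  Bakry–Émery identity `dS_N/dt = −2γ Σ_b w_b‖∂_{p_b}K_t p_N‖²` with both Gaussian integration-by-parts bounds inserted; the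
  engine is the statement that this budget is SPENT at an `N`-uniform integrable rate.
* `engine_shortTime_twoSided` (p134710 + p136877): `(T − D t)²/T ≤ S_N(t) ≤ T − t(√(2γT) − D'√t)²` uniformly in `N` for small `t`:
  the forecast norm leaves `T` linearly at the contact rate and no faster — the loss asserted by the engine can only come from
  times of order one and later (the escaped fraction), never from the contact layer.
* `crux_forces_conductanceFloor`, `crux_fouriersLaw_iff_coherentConverges` (p135913): necessary conditions / exact residual of
  the crux at route level. -/

/-- **Time-resolved forecast budget** (p136614), in the line's vocabulary. [folklore] -/
theorem engine_timeResolvedBudget {ω₂ lam β γ T : ℝ} (hω : 0 < ω₂) (hl : 0 ≤ lam) (hβ : 0 < β) (hγ : 0 < γ)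
    (hT : 0 < T) (N : ℕ) {t : ℝ} (ht : 0 ≤ t) :
    fnorm ω₂ lam β γ T N t + (2 * γ / T) * ∫ s in Ioc (0 : ℝ) t, ((pairCorr ω₂ lam β γ T N s) ^ 2 +
      (∫ z, z.2 (Fin.last N) * fcast ω₂ lam β γ T N s z ∂((pinnedChain ω₂ lam β γ).gibbsMeasure (N + 1) T)) ^ 2) ≤ T :=
  forecastBudget_timeResolved ω₂ lam β γ hω hl hβ hγ T hT N t ht

/-- **Two-sided `N`-uniform short-time law of the forecast norm** (contact loss p134710 from above, persistence p136877
from below): there are `D, D' ≥ 0` independent of `N` with `(T − D t)²/T ≤ S_N(t) ≤ T − t (√(2γT) − √t·D')²` whenever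
`0 ≤ t`, `D t ≤ T` and `√t·D' ≤ √(2γT)`. [folklore] -/
theorem engine_shortTime_twoSided {ω₂ lam β γ T : ℝ} (hω : 0 < ω₂) (hl : 0 ≤ lam) (hβ : 0 ≤ β) (hγ : 0 ≤ γ)
    (hT : 0 < T) :
    ∃ D D' : ℝ, 0 ≤ D ∧ 0 ≤ D' ∧ ∀ (N : ℕ) (t : ℝ), 0 ≤ t → D * t ≤ T → Real.sqrt t * D' ≤ Real.sqrt (2 * γ * T) →
      (T - D * t) ^ 2 / T ≤ fnorm ω₂ lam β γ T N t ∧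
        fnorm ω₂ lam β γ T N t ≤ T - t * (Real.sqrt (2 * γ * T) - Real.sqrt t * D') ^ 2 := by
  obtain ⟨D, hD0, hD⟩ := fnorm_persistence ω₂ lam β γ hω hl hβ hγ T hT
  obtain ⟨D', hD'0, hD'⟩ := contactLoss_fnorm_le ω₂ lam β γ hω hl hβ hγ T hT
  exact ⟨D, D', hD0, hD'0, fun N t ht hDt hD't => ⟨hD N t ht hDt, hD' N t ht hD't⟩⟩

/-- **The crux forces the conductance floor** (p135913): `IncoherentChannel → ConductanceLowerBound` (item
stmt-AtomisticToContinuum-11749 by name, as declared in route `JunctionLocality`; the other routes' copies are the same term). [folklore] -/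
theorem crux_forces_conductanceFloor :
    IncoherentChannel → Summit.AtomisticToContinuum.FouriersLaw.Theses.JunctionLocality.ConductanceLowerBound :=
  conductanceLowerBound_of_incoherentChannel

/-- **Given the crux, Fourier's law is exactly convergence of the coherent channel** (p135913). [folklore] -/
theorem crux_fouriersLaw_iff_coherentConverges (h : IncoherentChannel) :
    _root_.FouriersLaw ↔
      (∀ ω₂ lam β γ : ℝ, 0 < ω₂ → 0 < lam → 0 < β → 0 < γ → ∀ T : ℝ, 0 < T →
        ∃ c : ℝ, Tendsto (fun N : ℕ => (N : ℝ) * ∫ t in Ioi (0 : ℝ), (pairCorr ω₂ lam β γ T N t) ^ 2) atTop (𝓝 c)) :=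
  coherentConverges_iff_fouriersLaw_of_incoherentChannel h

/-! ## Line census (lead c4, 2026-08-17): time reversal — the coherent channel is the overlap of the two end forecasts

* `engine_pairCorr_sq_le_fnorm_sq` (p139625 ← p138456 + p138752): `r_N(2t)² ≤ S_N(t)²` for `N ≥ 1`, `t ≥ 0` — from
  `r_N(s+u) = −⟨v_u∘Θ, K_s p_0⟩` (kernel detailed balance + Chapman–Kolmogorov), Cauchy–Schwarz, and `‖K_s p_0‖² = S_N(s)` (reflection).
* `engine_abs_echo_le`, `engine_oddEven_split` (p139561): `|a_N(t)| ≤ S_N(t/2)` and `S_N(t) ± a_N(2t) = ½‖v_t ∓ v_t∘Θ‖²` — the forecast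
  norm is the SUM and the echo at double time the DIFFERENCE of the energies of the Θ-odd and Θ-even parts of the forecast.
* `coherentDephasing_of_sq`, `crux_iff_fouriersLaw_of_forecastLoss_sq` (p139625 ← p139163): the rank-2 crux from an `L²` engine (`α > 1`),
  and under it the crux `↔ FouriersLaw`. -/

/-- **`r_N(2t)² ≤ S_N(t)²`** (p139625): the coherent channel is quadratically small in the forecast norm. [folklore] -/
theorem engine_pairCorr_sq_le_fnorm_sq {ω₂ lam β γ T : ℝ} (hω : 0 < ω₂) (hl : 0 < lam) (hβ : 0 < β) (hγ : 0 < γ) (hT : 0 < T)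
    {N : ℕ} (hN : 1 ≤ N) {t : ℝ} (ht : 0 ≤ t) :
    (pairCorr ω₂ lam β γ T N (2 * t)) ^ 2 ≤ (fnorm ω₂ lam β γ T N t) ^ 2 :=
  pairCorr_sq_two_mul_le_fnorm_sq ω₂ lam β γ hω hl hβ hγ T hT N hN t ht

/-- **No coherent echo beyond the forecast norm at half time** (p139561): `|a_N(t)| ≤ S_N(t/2)`, with the echo
`a_N(t) = ⟨p_N, K_t p_N⟩_{μ₀}` written out as in the route file. [folklore] -/
theorem engine_abs_echo_le {ω₂ lam β γ T : ℝ} (hω : 0 < ω₂) (hl : 0 < lam) (hβ : 0 < β) (hγ : 0 < γ) (hT : 0 < T)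
    {N : ℕ} (hN : 1 ≤ N) {t : ℝ} (ht : 0 ≤ t) :
    |∫ z, z.2 (Fin.last N) * (∫ y, y.2 (Fin.last N)
        ∂((pinnedChain ω₂ lam β γ).transitionKernel (N + 1) T T t.toNNReal z))
        ∂((pinnedChain ω₂ lam β γ).gibbsMeasure (N + 1) T)| ≤ fnorm ω₂ lam β γ T N (t / 2) :=
  abs_endAutocorr_le_fnorm_half ω₂ lam β γ hω hl hβ hγ T hT N hN t ht

/-- **Odd/even split of the forecast under momentum reversal** (p139561): `S_N(t) + a_N(2t) = ½∫(v_t − v_t∘Θ)² dμ₀` and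
`S_N(t) − a_N(2t) = ½∫(v_t + v_t∘Θ)² dμ₀`. [folklore] -/
theorem engine_oddEven_split {ω₂ lam β γ T : ℝ} (hω : 0 < ω₂) (hl : 0 < lam) (hβ : 0 < β) (hγ : 0 < γ) (hT : 0 < T)
    {N : ℕ} (hN : 1 ≤ N) {t : ℝ} (ht : 0 ≤ t) :
    (fnorm ω₂ lam β γ T N t + ∫ z, z.2 (Fin.last N) * fcast ω₂ lam β γ T N (2 * t) z
        ∂((pinnedChain ω₂ lam β γ).gibbsMeasure (N + 1) T) =
      (1 / 2) * ∫ z, (fcast ω₂ lam β γ T N t z - fcast ω₂ lam β γ T N t (z.1, -z.2)) ^ 2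
        ∂((pinnedChain ω₂ lam β γ).gibbsMeasure (N + 1) T)) ∧
    (fnorm ω₂ lam β γ T N t - ∫ z, z.2 (Fin.last N) * fcast ω₂ lam β γ T N (2 * t) z
        ∂((pinnedChain ω₂ lam β γ).gibbsMeasure (N + 1) T) =
      (1 / 2) * ∫ z, (fcast ω₂ lam β γ T N t z + fcast ω₂ lam β γ T N t (z.1, -z.2)) ^ 2
        ∂((pinnedChain ω₂ lam β γ).gibbsMeasure (N + 1) T)) :=
  ⟨fnorm_add_echo_eq ω₂ lam β γ hω hl hβ hγ T hT N hN t ht, fnorm_sub_echo_eq ω₂ lam β γ hω hl hβ hγ T hT N hN t ht⟩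

/-- **The rank-2 crux from a square-integrable engine** (p139625): `CoherentDephasing` BY NAME from an `N`-uniform envelope
`S_N ≤ C(1+t)^{−α}` with `α > 1` — half the exponent of the registered `stub_forecastLoss`. CONDITIONAL on the envelope. [folklore] -/
theorem coherentDephasing_of_sq
    (h : ∀ ω₂ lam β γ : ℝ, 0 < ω₂ → 0 < lam → 0 < β → 0 < γ → ∀ T : ℝ, 0 < T →
      ∃ C α : ℝ, 1 < α ∧ ∀ (N : ℕ) (t : ℝ), 0 ≤ t → fnorm ω₂ lam β γ T N t ≤ C * (1 + t) ^ (-α)) :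
    CoherentDephasing :=
  coherentDephasing_of_forecastLoss_sq h

/-- **Under the square-integrable engine the crux IS the conjunct** (p139625). CONDITIONAL on the envelope. [folklore] -/
theorem crux_iff_fouriersLaw_of_forecastLoss_sq
    (h : ∀ ω₂ lam β γ : ℝ, 0 < ω₂ → 0 < lam → 0 < β → 0 < γ → ∀ T : ℝ, 0 < T →
      ∃ C α : ℝ, 1 < α ∧ ∀ (N : ℕ) (t : ℝ), 0 ≤ t → fnorm ω₂ lam β γ T N t ≤ C * (1 + t) ^ (-α)) :
    IncoherentChannel ↔ _root_.FouriersLaw :=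
  incoherentChannel_iff_fouriersLaw_of_forecastLoss_sq h

/-! ## Line census (lead c4, cycle 2, 2026-08-17): the left-sensitivity budget and the global-flip parity of the forecast

* `engine_leftSensitivityBudget` (p141137 + p141544, assembly `leftSensitivity_budget_holds`): `∫_{0<s≤t} D_N(s) ds ≤ π²T/(8γ)` for
  every `N`, `t > 0`, `D_N(s) = ∫(v_s(z) − v_s(z̃))² d(μ₀⊗ν)` — uniformly in the length of the chain, the far forecast is sensitive to
  the initial near-bath momentum only within a fixed `L²(ds)` budget.
* `engine_crossTerms_le_leftSensitivity` (`lightCone_reduction`, p92940 chain): `r_N² ≤ T·D_N` and `|P_N| ≤ K√D_N` — both cross terms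
  of the line are read off `D_N`; hence `commonPast_sq_budget` (p141111 + assembly): `∫₀^∞ P_N² ≤ C` for every `N`.
* `fcast_parity`, `fcast_orthogonal_even` (p141353): `v_t(−z) = −v_t(z)` and `∫ G v_t dμ₀ = 0` for every `Π`-even `G` — the forecast
  is orthogonal to the Hamiltonian and to every energy density (the conserved / hydrodynamic fields of this chain are `Π`-even). -/

/-- **Left-sensitivity budget, `N`-uniform** (`leftSensitivity_budget_holds`). [folklore] -/
theorem engine_leftSensitivityBudget : ∀ ω₂ lam β γ : ℝ, 0 < ω₂ → 0 ≤ lam → 0 < β → 0 < γ → ∀ T : ℝ, 0 < T →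
    ∀ (N : ℕ) (t : ℝ), 0 < t → ∫⁻ s in Ioc (0 : ℝ) t, ENNReal.ofReal (∫ x : PhaseSpace (N + 1) × ℝ, (fcast ω₂ lam β γ T N s x.1 - fcast ω₂ lam β γ T N s ((x.1.1, Function.update x.1.2 0 x.2) : PhaseSpace (N + 1))) ^ 2 ∂(((pinnedChain ω₂ lam β γ).gibbsMeasure (N + 1) T).prod (ProbabilityTheory.gaussianReal 0 T.toNNReal))) ≤ ENNReal.ofReal (Real.pi ^ 2 * T / (8 * γ)) :=
  leftSensitivity_budget_holds

/-- **Both cross terms are controlled by the left sensitivity** (`lightCone_reduction`): `∃ K = K(T) ≥ 0` with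
`r_N(t)² ≤ T·D_N(t)` and `|P_N(t)| ≤ K√(D_N(t))` for all `N`, `t`. [folklore] -/
theorem engine_crossTerms_le_leftSensitivity : ∀ ω₂ lam β γ : ℝ, 0 < ω₂ → 0 ≤ lam → 0 ≤ β → 0 ≤ γ → ∀ T : ℝ, 0 < T →
    ∃ K : ℝ, 0 ≤ K ∧ ∀ (N : ℕ) (t : ℝ),
      (pairCorr ω₂ lam β γ T N t) ^ 2 ≤ T * ∫ x : PhaseSpace (N + 1) × ℝ, (fcast ω₂ lam β γ T N t x.1 -
          fcast ω₂ lam β γ T N t ((x.1.1, Function.update x.1.2 0 x.2) : PhaseSpace (N + 1))) ^ 2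
          ∂(((pinnedChain ω₂ lam β γ).gibbsMeasure (N + 1) T).prod (ProbabilityTheory.gaussianReal 0 T.toNNReal)) ∧
      |commonPast ω₂ lam β γ T N t| ≤ K * Real.sqrt (∫ x : PhaseSpace (N + 1) × ℝ, (fcast ω₂ lam β γ T N t x.1 -
          fcast ω₂ lam β γ T N t ((x.1.1, Function.update x.1.2 0 x.2) : PhaseSpace (N + 1))) ^ 2
          ∂(((pinnedChain ω₂ lam β γ).gibbsMeasure (N + 1) T).prod (ProbabilityTheory.gaussianReal 0 T.toNNReal))) :=
  lightCone_reduction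

/-- **The common-past term is `N`-uniformly square-integrable in time** (`commonPast_sq_integral_le`). [folklore] -/
theorem commonPast_sq_budget : ∀ ω₂ lam β γ : ℝ, 0 < ω₂ → 0 < lam → 0 < β → 0 < γ → ∀ T : ℝ, 0 < T →
    ∃ C : ℝ, ∀ N : ℕ, IntegrableOn (fun s => (commonPast ω₂ lam β γ T N s) ^ 2) (Ioi (0 : ℝ)) ∧
      ∫ s in Ioi (0 : ℝ), (commonPast ω₂ lam β γ T N s) ^ 2 ≤ C :=
  commonPast_sq_integral_le

/-- **The forecast is odd under the global flip** `Π(q,p) = (−q,−p)` (`fcast_neg`). [folklore] -/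
theorem fcast_parity {ω₂ lam β γ : ℝ} (hω : 0 < ω₂) (hl : 0 ≤ lam) (hβ : 0 ≤ β) (hγ : 0 ≤ γ) (T : ℝ) (N : ℕ)
    (t : ℝ) (z : PhaseSpace (N + 1)) : fcast ω₂ lam β γ T N t (-z) = -fcast ω₂ lam β γ T N t z :=
  fcast_neg ω₂ lam β γ hω hl hβ hγ T N t z

/-- **The forecast is `L²(μ₀)`-orthogonal to every `Π`-even observable** (`integral_even_mul_fcast`) — in particular to
the Hamiltonian and to all energy densities. [folklore] -/
theorem fcast_orthogonal_even {ω₂ lam β γ : ℝ} (hω : 0 < ω₂) (hl : 0 ≤ lam) (hβ : 0 ≤ β) (hγ : 0 ≤ γ) (T : ℝ) (N : ℕ)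
    (t : ℝ) {G : PhaseSpace (N + 1) → ℝ} (hG : ∀ z, G (-z) = G z) :
    ∫ z, G z * fcast ω₂ lam β γ T N t z ∂((pinnedChain ω₂ lam β γ).gibbsMeasure (N + 1) T) = 0 :=
  integral_even_mul_fcast ω₂ lam β γ hω hl hβ hγ T N t G hG

/-! ## Line census (lead c5, cycle 1, 2026-08-17): the semigroup (tail) form of the budget and the one-time engine

* `engine_tailBudget` (p148747 ← p144914): `(2γ/T)∫_{t>t₁}(r_N² + a_N²) ≤ S_N(t₁)` for every `N`, `t₁ ≥ 0` — the coherent budget still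
  unspent at time `t₁` is at most `(T/2γ)·S_N(t₁)`.
* `engine_leftSensitivity_tail` (p147650 ← p145885): `∫_{(0,t]} D_N(t₁+s) ds ≤ π²/(8γ)·S_N(t₁)` — the left sensitivity, hence the common-past
  term (`…CommonPastTail`), has its tail slaved to `S_N(t₁)` too.
* ONE-TIME ENGINE (`…OneTimeEngine`, lead): `CoherentDephasing` from `∃ η ∈ (0,1), N·S_N(N^η) → 0`; under it the crux `↔ FouriersLaw`. -/

/-- **Tail budget** (p148747): `(2γ/T)∫_{t>t₁}(r_N(t)² + a_N(t)²) dt ≤ S_N(t₁)` for all `N`, `t₁ ≥ 0`. [folklore] -/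
theorem engine_tailBudget {ω₂ lam β γ T : ℝ} (hω : 0 < ω₂) (hl : 0 ≤ lam) (hβ : 0 < β) (hγ : 0 < γ) (hT : 0 < T)
    (N : ℕ) {t₁ : ℝ} (ht₁ : 0 ≤ t₁) :
    (2 * γ / T) * ∫ s in Ioi t₁, ((pairCorr ω₂ lam β γ T N s) ^ 2 +
      (∫ z, z.2 (Fin.last N) * fcast ω₂ lam β γ T N s z ∂((pinnedChain ω₂ lam β γ).gibbsMeasure (N + 1) T)) ^ 2) ≤
      fnorm ω₂ lam β γ T N t₁ :=
  forecastBudget_tail ω₂ lam β γ hω hl hβ hγ T hT N t₁ ht₁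

/-- **Left-sensitivity tail budget** (p147650): `∫_{(0,t]} D_N(t₁+s) ds ≤ π²/(8γ)·S_N(t₁)` (lower integral in `s`). [folklore] -/
theorem engine_leftSensitivity_tail {ω₂ lam β γ T : ℝ} (hω : 0 < ω₂) (hl : 0 ≤ lam) (hβ : 0 < β) (hγ : 0 < γ)
    (hT : 0 < T) (N : ℕ) {t₁ t : ℝ} (ht₁ : 0 ≤ t₁) (ht : 0 < t) :
    ∫⁻ s in Ioc (0 : ℝ) t, ENNReal.ofReal (∫ x : PhaseSpace (N + 1) × ℝ, (fcast ω₂ lam β γ T N (t₁ + s) x.1 -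
        fcast ω₂ lam β γ T N (t₁ + s) ((x.1.1, Function.update x.1.2 0 x.2) : PhaseSpace (N + 1))) ^ 2
        ∂(((pinnedChain ω₂ lam β γ).gibbsMeasure (N + 1) T).prod (ProbabilityTheory.gaussianReal 0 T.toNNReal))) ≤
      ENNReal.ofReal (Real.pi ^ 2 / (8 * γ) * fnorm ω₂ lam β γ T N t₁) :=
  leftSensitivity_tail_budget ω₂ lam β γ hω hl hβ hγ T hT N t₁ t ht₁ ht

/-- **Common-past tail** (p150300): `∃ C` independent of `N` with `∫₀^∞ P_N(t₁+s)² ds ≤ C·S_N(t₁)` for all `N`, `t₁ ≥ 0`. [folklore] -/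
theorem engine_commonPast_tail : ∀ ω₂ lam β γ : ℝ, 0 < ω₂ → 0 < lam → 0 < β → 0 < γ → ∀ T : ℝ, 0 < T →
    ∃ C : ℝ, 0 ≤ C ∧ ∀ (N : ℕ) (t₁ : ℝ), 0 ≤ t₁ →
      IntegrableOn (fun s => (commonPast ω₂ lam β γ T N (t₁ + s)) ^ 2) (Ioi (0 : ℝ)) ∧
      ∫ s in Ioi (0 : ℝ), (commonPast ω₂ lam β γ T N (t₁ + s)) ^ 2 ≤ C * fnorm ω₂ lam β γ T N t₁ :=
  commonPast_sq_tail_le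

/-- **ONE-TIME ENGINE ⇒ the rank-2 crux** (p149873): `CoherentDephasing` BY NAME from `∃ η ∈ (0,1), N·S_N(N^η) → 0` at every
parameter point. CONDITIONAL on that hypothesis (weaker than `stub_forecastLoss`). [folklore] -/
theorem coherentDephasing_of_oneTime'
    (h1 : ∀ ω₂ lam β γ : ℝ, 0 < ω₂ → 0 < lam → 0 < β → 0 < γ → ∀ T : ℝ, 0 < T →
      ∃ η : ℝ, 0 < η ∧ η < 1 ∧ Tendsto (fun N : ℕ => (N : ℝ) * fnorm ω₂ lam β γ T N ((N : ℝ) ^ η)) atTop (𝓝 0)) :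
    CoherentDephasing :=
  coherentDephasing_of_oneTime h1

/-- **Under the one-time engine the crux IS the conjunct** (p149873). CONDITIONAL. [folklore] -/
theorem crux_iff_fouriersLaw_of_oneTime
    (h1 : ∀ ω₂ lam β γ : ℝ, 0 < ω₂ → 0 < lam → 0 < β → 0 < γ → ∀ T : ℝ, 0 < T →
      ∃ η : ℝ, 0 < η ∧ η < 1 ∧ Tendsto (fun N : ℕ => (N : ℝ) * fnorm ω₂ lam β γ T N ((N : ℝ) ^ η)) atTop (𝓝 0)) :
    IncoherentChannel ↔ _root_.FouriersLaw :=
  incoherentChannel_iff_fouriersLaw_of_oneTime h1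

/-- **The registered engine gives the one-time hypothesis** (p149873; `stub_forecastLoss` has `α > 2 > 1`). [folklore] -/
theorem oneTime_of_stub1 (h₁ : stub_forecastLoss) :
    ∀ ω₂ lam β γ : ℝ, 0 < ω₂ → 0 < lam → 0 < β → 0 < γ → ∀ T : ℝ, 0 < T →
      ∃ η : ℝ, 0 < η ∧ η < 1 ∧ Tendsto (fun N : ℕ => (N : ℝ) * fnorm ω₂ lam β γ T N ((N : ℝ) ^ η)) atTop (𝓝 0) := by
  refine oneTime_of_forecastLoss_sq (fun ω₂ lam β γ hω hl hβ hγ T hT => ?_)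
  obtain ⟨C, α, hα, h⟩ := h₁ ω₂ lam β γ hω hl hβ hγ T hT
  exact ⟨C, α, by linarith, h⟩

/-! ## Line census (lead c6, cycle 1, 2026-08-17): the harmonic corner EXACTLY — dissipation identity, sum rule, plateau; the one-time engine is calibrated

* `engine_harmonic_dissipation` (`…HarmonicDissipation.lean`, p155138 ← W-A p153741, W-B p153765, W-C p154074, W-E p153976): at `lam = β = 0`,
  `dS_N/dt = −(2γ/T)(r_N(t)² + a_N(t)²)` for every `N`, `t > 0` — EQUALITY.
* `engine_harmonic_sumRule` (`…HarmonicTailBudget.lean`, p155547): `∫₀^∞ (r_N² + a_N²) = T²/(2γ)` for every `N` at the corner.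
* `engine_harmonic_plateau`, `oneTime_false_harmonic'` (`…HarmonicTailBudget.lean`, p155547 ← W-D p153760): eventually `S_N(t) ≥ T c_∞/(2γ)` on
  `[0, N^η]`, hence the one-time hypothesis FAILS at `lam = β = 0` for every `η ∈ (0,1)`. -/

/-- **Exact dissipation of the forecast norm at the harmonic corner** (`harmonic_fnorm_dissipation`). [folklore] -/
theorem engine_harmonic_dissipation {ω₂ γ T : ℝ} (hω : 0 < ω₂) (hγ : 0 < γ) (hT : 0 < T) (N : ℕ) {t : ℝ} (ht : 0 < t) :
    HasDerivAt (fun s => fnorm ω₂ 0 0 γ T N s)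
      (-(2 * γ / T) * ((pairCorr ω₂ 0 0 γ T N t) ^ 2 +
        (∫ z, z.2 (Fin.last N) * fcast ω₂ 0 0 γ T N t z ∂((pinnedChain ω₂ 0 0 γ).gibbsMeasure (N + 1) T)) ^ 2)) t :=
  harmonic_fnorm_dissipation ω₂ γ hω hγ T hT N t ht

/-- **Exact forecast sum rule at the harmonic corner** (`harmonic_forecast_sumRule_closed`): the `N`-uniform budget `≤ T²/(2γ)`
(`engine_forecastBudget`, p135026) is SATURATED at `lam = β = 0`. [folklore] -/
theorem engine_harmonic_sumRule {ω₂ γ T : ℝ} (hω : 0 < ω₂) (hγ : 0 < γ) (hT : 0 < T) (N : ℕ) :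
    ∫ s in Ioi (0 : ℝ), ((pairCorr ω₂ 0 0 γ T N s) ^ 2 +
        (∫ z, z.2 (Fin.last N) * fcast ω₂ 0 0 γ T N s z ∂((pinnedChain ω₂ 0 0 γ).gibbsMeasure (N + 1) T)) ^ 2) =
      T ^ 2 / (2 * γ) :=
  harmonic_forecast_sumRule_closed ω₂ γ hω hγ T hT N

/-- **The harmonic plateau** (`harmonic_forecast_plateau`): eventually in `N`, `S_N(t) ≥ T·c_∞/(2γ)` for `0 ≤ t ≤ N^η`. [folklore] -/
theorem engine_harmonic_plateau {ω₂ γ T : ℝ} (hω : 0 < ω₂) (hγ : 0 < γ) (hT : 0 < T) {η : ℝ} (hη0 : 0 < η) (hη1 : η < 1) :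
    ∀ᶠ N : ℕ in atTop, ∀ t : ℝ, 0 ≤ t → t ≤ (N : ℝ) ^ η → T * fluxLimit ω₂ γ / (2 * γ) ≤ fnorm ω₂ 0 0 γ T N t :=
  harmonic_forecast_plateau ω₂ γ hω hγ T hT η hη0 hη1

/-- **Where the ONE-TIME engine uses `0 < lam ∧ 0 < β`** (`oneTime_false_harmonic`): at the harmonic corner the hypothesis of
`coherentDephasing_of_oneTime'` fails for every `η ∈ (0,1)`. [folklore] -/
theorem oneTime_false_harmonic' {ω₂ γ T : ℝ} (hω : 0 < ω₂) (hγ : 0 < γ) (hT : 0 < T) {η : ℝ} (hη0 : 0 < η) (hη1 : η < 1) :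
    ¬ Tendsto (fun N : ℕ => (N : ℝ) * fnorm ω₂ 0 0 γ T N ((N : ℝ) ^ η)) atTop (𝓝 0) :=
  oneTime_false_harmonic ω₂ γ hω hγ T hT η hη0 hη1


/-! ## Line census (lead c7, cycle 1, 2026-08-17): cross-crux accounting — strict budget, engine ⇒ T1, fixed-N truth, and the N-UNIFORM ANHARMONIC LOSS of the forecast norm (all LANDED)

Cross-crux accounting with the sibling crux `CoherentDephasing` (stmt-11810), whose line landed the `N`-uniform STRICT ABSORPTION
theorem (`CoherentDephasing.StrictAbsorption.strictAbsorption`, p135295) and the temporal child T1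
(`CoherentDephasing.TimeWeighted.coherentDephasing_of_timeWeightedResponse`, p132858) after this line's budget files were written:
* `echo_eq_momResp_zero`, `strictForecastBudget` (worker W-A): by site reflection the echo `a_N = ⟨p_N, K_t p_N⟩` is the kick's
  near autoresponse `m_0` and `r_N = m_N`, so strict absorption is the `N`-UNIFORM STRICT FORECAST BUDGET
  `∫₀^∞ (r_N² + a_N²) ≤ T²/(2γ) − c` (`N ≥ 2`): the budget p135026 is saturated (`= T²/(2γ)`, p155547) iff `lam = β = 0`.
* `timeWeightedResponse_of_forecastLoss` (worker W-B): the registered engine gives the sibling's T1 hypothesis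
  (`a = α/2`, `r_N² ≤ T·S_N`), an independent second composition engine ⇒ `CoherentDephasing`.
* `witness_timeResolved_lintegral_le` (worker W-C, p158070, `Theorems/…WitnessTimeResolved.lean`): the sibling's witnessed Landauer bound
  (`sa_witnessLintegral`) with the forecast-norm term KEPT and a finite horizon — `V·(T/2γ)‖K_t p₀‖² + ∫₀ᵗ{V[m_0² + m_N²] + A²} ≤ V T²/(2γ)`
  for every centred `C¹` position witness `g` (`V = ∫g²`, `A = ⟨p₀ g, K_s p₀⟩`); reusable `witness_integrated_timeResolved` (C_c data).
* `coherentBudget_antitone` (lead, p158264): the coherent budget `S_N(t) + (2γ/T)∫₀ᵗ(r_N² + a_N²)` is non-increasing in `t` (every chain, every `N`).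
* `anharmonicShortTimeLoss`, `anharmonicLoss_allTimes` (LEAD, p158540, from W-C + the sibling's `N`-uniform which-path expansion
  `A(s) = −T·VarΦ·s²/2 + O(s³)` and variance floor): **`N`-UNIFORM ANHARMONIC LOSS** — `∃ c, r₀ > 0` independent of `N ≥ 2` with
  `S_N(t) + (2γ/T)∫₀ᵗ(r_N² + a_N²) ≤ T − c·(min t r₀)⁵` for every `t ≥ 0`; at `lam = β = 0` the left side EQUALS `T` for every `t`
  (`engine_harmonic_budget_identity` from p155138): the incoherent dissipation of the forecast is `≥ c t⁵` at short times and `≥ c r₀⁵`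
  ever after, uniformly in `N`. -/

/-- **The echo is the kick's near autoresponse** (`echo_eq_momResp_zero`, LANDED p157590, worker W-A): `a_N(t) = m_0(t)` by site
reflection of the equal-temperature chain. [folklore] -/
theorem engine_echo_eq_momResp {ω₂ lam β γ : ℝ} (hω : 0 < ω₂) (hl : 0 ≤ lam) (hβ : 0 ≤ β) (hγ : 0 ≤ γ) (T : ℝ) (N : ℕ) (t : ℝ) :
    ∫ z, z.2 (Fin.last N) * fcast ω₂ lam β γ T N t z ∂((pinnedChain ω₂ lam β γ).gibbsMeasure (N + 1) T) =
      momResp ω₂ lam β γ T N 0 t :=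
  echo_eq_momResp_zero ω₂ lam β γ hω hl hβ hγ T N t

/-- **The `N`-uniform STRICT forecast budget** (`strictForecastBudget`, LANDED p157590, worker W-A ← the sibling crux's strict
absorption p135295): `∃ c > 0, ∀ N ≥ 2, ∫₀^∞ (r_N² + a_N²) ≤ T²/(2γ) − c`. With `engine_harmonic_sumRule` (`= T²/(2γ)` at
`lam = β = 0`, p155547): the `N`-uniform forecast budget p135026 is SATURATED IFF THE CHAIN IS HARMONIC. [folklore] -/
theorem engine_strictForecastBudget {ω₂ lam β γ : ℝ} (hω : 0 < ω₂) (hl : 0 < lam) (hβ : 0 < β) (hγ : 0 < γ) {T : ℝ} (hT : 0 < T) :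
    ∃ c : ℝ, 0 < c ∧ ∀ N : ℕ, 2 ≤ N → ∫ t in Ioi (0 : ℝ), ((pairCorr ω₂ lam β γ T N t) ^ 2 +
      (∫ z, z.2 (Fin.last N) * fcast ω₂ lam β γ T N t z ∂((pinnedChain ω₂ lam β γ).gibbsMeasure (N + 1) T)) ^ 2) ≤
        T ^ 2 / (2 * γ) - c :=
  strictForecastBudget ω₂ lam β γ hω hl hβ hγ T hT

/-- **The registered engine gives the sibling crux's temporal child T1** (`timeWeightedResponse_of_forecastLoss`, LANDED p157582,
worker W-B): from stub 1, `∃ a > 1, C` with `∫_{(0,R]} (1+t)^a r_N² ≤ C` for all `N, R` (`a = α/2`, `r_N² ≤ T·S_N`). [folklore] -/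
theorem engine_timeWeighted_of_stub1 (h₁ : stub_forecastLoss) :
    ∀ ω₂ lam β γ : ℝ, 0 < ω₂ → 0 < lam → 0 < β → 0 < γ → ∀ T : ℝ, 0 < T → ∃ a C : ℝ, 1 < a ∧ ∀ (N : ℕ) (R : ℝ), 0 < R →
      ∫ t in Ioc 0 R, (1 + t) ^ a * (pairCorr ω₂ lam β γ T N t) ^ 2 ≤ C :=
  timeWeightedResponse_of_forecastLoss h₁

/-- **A second, independent composition engine ⇒ `CoherentDephasing`**: stub 1 ⇒ T1 (W-B) ⇒ the rank-2 crux by the SIBLING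
line's glue `CoherentDephasing.TimeWeighted.coherentDephasing_of_timeWeightedResponse` (p132858) — cross-check of
`coherentDephasing_of` by a different split of `(0,∞)`. CONDITIONAL on stub 1. [folklore] -/
theorem coherentDephasing_of_stub1_viaT1 (h₁ : stub_forecastLoss) : CoherentDephasing :=
  Summit.AtomisticToContinuum.FouriersLaw.Theorems.CoherentDephasing.TimeWeighted.coherentDephasing_of_timeWeightedResponse
    (timeWeightedResponse_of_forecastLoss h₁)

/-- **The engine holds chain by chain** (fixed-`N` truth of stub 1, from the landed exponential shadow `fnorm_le_exp`, p87312 ←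
CEHR 2018 Harris theorem): for every `N` there are `C, α > 2` with `S_N(t) ≤ C(1+t)^{−α}` for all `t ≥ 0` — the registered stub with
its quantifiers SWAPPED (`∀ N ∃ C α` instead of `∃ C α ∀ N`). The ENTIRE open content of the engine is the uniformity of `(C, α)` in
the length. [folklore] -/
theorem engine_fixedN {ω₂ lam β γ : ℝ} (hω : 0 < ω₂) (hl : 0 < lam) (hβ : 0 < β) (hγ : 0 < γ) {T : ℝ} (hT : 0 < T) (N : ℕ) :
    ∃ C α : ℝ, 2 < α ∧ ∀ t : ℝ, 0 ≤ t → fnorm ω₂ lam β γ T N t ≤ C * (1 + t) ^ (-α) := by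
  obtain ⟨A, c, hA, hc, h⟩ := fnorm_le_exp ω₂ lam β γ hω hl hβ hγ T hT N
  -- `δ = min 1 (c/3)`: `(1+t)³ ≤ δ⁻³ e^{3δt} ≤ δ⁻³ e^{ct}`
  set δ : ℝ := min 1 (c / 3) with hδ
  have hδ0 : 0 < δ := by rw [hδ]; exact lt_min one_pos (by positivity)
  have hδ1 : δ ≤ 1 := min_le_left _ _
  have hδc : 3 * δ ≤ c := by
    have := min_le_right 1 (c / 3); rw [← hδ] at this; linarith
  refine ⟨A / δ ^ 3, 3, by norm_num, fun t ht => ?_⟩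
  have h1t : 0 < 1 + t := by linarith
  -- `(1+t)^3 e^{-ct} ≤ δ⁻³`
  have hkey : (1 + t) ^ (3 : ℕ) * Real.exp (-c * t) ≤ 1 / δ ^ 3 := by
    have h1 : 1 + t ≤ (1 / δ) * Real.exp (δ * t) := by
      have e1 : δ * t + 1 ≤ Real.exp (δ * t) := Real.add_one_le_exp _
      rw [div_mul_eq_mul_div, le_div_iff₀ hδ0, one_mul]
      nlinarith [mul_nonneg hδ0.le ht]
    have h2 : (1 + t) ^ (3 : ℕ) ≤ ((1 / δ) * Real.exp (δ * t)) ^ (3 : ℕ) := pow_le_pow_left₀ h1t.le h1 3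
    have h3 : ((1 / δ) * Real.exp (δ * t)) ^ (3 : ℕ) = (1 / δ ^ 3) * Real.exp (3 * δ * t) := by
      rw [mul_pow, ← Real.exp_nat_mul]; push_cast; ring_nf
    have h4 : Real.exp (3 * δ * t) * Real.exp (-c * t) ≤ 1 := by
      rw [← Real.exp_add]
      apply Real.exp_le_one_iff.2
      nlinarith [mul_le_mul_of_nonneg_right hδc ht]
    calc (1 + t) ^ (3 : ℕ) * Real.exp (-c * t) ≤ (1 / δ ^ 3) * Real.exp (3 * δ * t) * Real.exp (-c * t) := by
          rw [← h3]; exact mul_le_mul_of_nonneg_right h2 (Real.exp_pos _).le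
      _ = (1 / δ ^ 3) * (Real.exp (3 * δ * t) * Real.exp (-c * t)) := by ring
      _ ≤ (1 / δ ^ 3) * 1 := mul_le_mul_of_nonneg_left h4 (by positivity)
      _ = 1 / δ ^ 3 := by ring
  have hrpow : (1 + t) ^ (-(3 : ℝ)) = ((1 + t) ^ (3 : ℕ))⁻¹ := by
    rw [Real.rpow_neg h1t.le, ← Real.rpow_natCast]; norm_num
  have hp3 : 0 < (1 + t) ^ (3 : ℕ) := pow_pos h1t 3
  calc fnorm ω₂ lam β γ T N t ≤ A * Real.exp (-c * t) := h t ht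
    _ = A * ((1 + t) ^ (3 : ℕ) * Real.exp (-c * t)) * ((1 + t) ^ (3 : ℕ))⁻¹ := by
        field_simp
    _ ≤ A * (1 / δ ^ 3) * ((1 + t) ^ (3 : ℕ))⁻¹ := by
        gcongr
    _ = A / δ ^ 3 * (1 + t) ^ (-(3 : ℝ)) := by rw [hrpow]; ring

/-- **The harmonic contrast** (from c6's dissipation identity p155138): at `lam = β = 0` the time-resolved forecast budget is an
IDENTITY for every `N` and `t ≥ 0`, `S_N(t) + (2γ/T)∫₀ᵗ(r_N² + a_N²) = T` — so `anharmonicShortTimeLoss` below is a strict,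
`N`-uniform use of `0 < lam ∧ 0 < β` on the engine's own object. [folklore] -/
theorem engine_harmonic_budget_identity {ω₂ γ T : ℝ} (hω : 0 < ω₂) (hγ : 0 < γ) (hT : 0 < T) (N : ℕ) {t : ℝ} (ht : 0 ≤ t) :
    fnorm ω₂ 0 0 γ T N t + (2 * γ / T) * ∫ s in Ioc (0 : ℝ) t, ((pairCorr ω₂ 0 0 γ T N s) ^ 2 +
      (∫ z, z.2 (Fin.last N) * fcast ω₂ 0 0 γ T N s z ∂((pinnedChain ω₂ 0 0 γ).gibbsMeasure (N + 1) T)) ^ 2) = T := by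
  have h := harmonic_fnorm_sub_eq_integral hω hγ hT N le_rfl ht
  have h0 : fnorm ω₂ 0 0 γ T N 0 = T := by
    rw [harmonic_fnorm_eq_integral_freeFlow hω hγ hT N 0]
    simp only [pinnedChain_freeFlow_zero]
    exact Summit.AtomisticToContinuum.FouriersLaw.Theorems.IncoherentChannel.Negative.GibbsStein.gibbs_sq_momentum
      hω le_rfl le_rfl hT (Fin.last N)
  rw [h0, intervalIntegral.integral_of_le ht] at h
  linarith

/-- **The coherent budget is non-increasing** (`coherentBudget_antitone`, LANDED p158264, lead): for every chain of the family
(`lam ≥ 0`, `β, γ > 0`), every `N` and `0 ≤ t₁ ≤ t₂`, `B_N(t₂) ≤ B_N(t₁)` with `B_N(t) = S_N(t) + (2γ/T)∫_{(0,t]}(r_N² + a_N²)` — the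
finite-window budget with the forecast-norm term kept (`B_N ≡ T` at `lam = β = 0`, `engine_harmonic_budget_identity`). [folklore] -/
theorem engine_coherentBudget_antitone {ω₂ lam β γ : ℝ} (hω : 0 < ω₂) (hl : 0 ≤ lam) (hβ : 0 < β) (hγ : 0 < γ) {T : ℝ} (hT : 0 < T)
    (N : ℕ) {t₁ t₂ : ℝ} (h0 : 0 ≤ t₁) (h12 : t₁ ≤ t₂) :
    fnorm ω₂ lam β γ T N t₂ + (2 * γ / T) * ∫ s in Ioc (0 : ℝ) t₂, ((pairCorr ω₂ lam β γ T N s) ^ 2 +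
        (∫ z, z.2 (Fin.last N) * fcast ω₂ lam β γ T N s z ∂((pinnedChain ω₂ lam β γ).gibbsMeasure (N + 1) T)) ^ 2) ≤
      fnorm ω₂ lam β γ T N t₁ + (2 * γ / T) * ∫ s in Ioc (0 : ℝ) t₁, ((pairCorr ω₂ lam β γ T N s) ^ 2 +
        (∫ z, z.2 (Fin.last N) * fcast ω₂ lam β γ T N s z ∂((pinnedChain ω₂ lam β γ).gibbsMeasure (N + 1) T)) ^ 2) :=
  coherentBudget_antitone ω₂ lam β γ hω hl hβ hγ T hT N t₁ t₂ h0 h12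

/-- **`N`-UNIFORM ANHARMONIC SHORT-TIME LOSS** (`anharmonicShortTimeLoss`, LANDED p158540, lead ← W-C `witness_timeResolved_lintegral_le`
p158070 + W-A `echo_eq_momResp_zero` p157590 + the sibling crux's `N`-uniform which-path expansion and variance floor, p135295 family):
`∃ c, r₀ > 0, ∀ N ≥ 2, ∀ t ∈ [0, r₀]: S_N(t) + (2γ/T)∫₀ᵗ(r_N² + a_N²) ≤ T − c·t⁵`. At `lam = β = 0` the left side is `= T`
(`engine_harmonic_budget_identity`): the INCOHERENT dissipation of the forecast (slack of the Jensen step in the Bakry–Émery identity) is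
`≥ c t⁵`, uniformly in the length — the first `N`-uniform use of anharmonicity on the engine's own object. [folklore] -/
theorem engine_anharmonicShortTimeLoss {ω₂ lam β γ : ℝ} (hω : 0 < ω₂) (hl : 0 < lam) (hβ : 0 < β) (hγ : 0 < γ) {T : ℝ} (hT : 0 < T) :
    ∃ c r₀ : ℝ, 0 < c ∧ 0 < r₀ ∧ ∀ N : ℕ, 2 ≤ N → ∀ t : ℝ, 0 ≤ t → t ≤ r₀ →
      fnorm ω₂ lam β γ T N t + (2 * γ / T) * ∫ s in Ioc (0 : ℝ) t, ((pairCorr ω₂ lam β γ T N s) ^ 2 +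
        (∫ z, z.2 (Fin.last N) * fcast ω₂ lam β γ T N s z ∂((pinnedChain ω₂ lam β γ).gibbsMeasure (N + 1) T)) ^ 2) ≤ T - c * t ^ 5 :=
  anharmonicShortTimeLoss ω₂ lam β γ hω hl hβ hγ T hT

/-- **`N`-UNIFORM ANHARMONIC LOSS AT ALL TIMES** (`anharmonicLoss_allTimes`, LANDED p158540): for every `N ≥ 2` and EVERY `t ≥ 0`,
`S_N(t) + (2γ/T)∫₀ᵗ(r_N² + a_N²) ≤ T − c·(min t r₀)⁵` — the coherent budget identity of the harmonic corner fails by a FIXED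
`N`-independent amount from time `r₀` on (short-time loss + `engine_coherentBudget_antitone`); letting `t → ∞` at fixed `N` this contains
the strict budget `engine_strictForecastBudget` with a named mechanism. [folklore] -/
theorem engine_anharmonicLoss_allTimes {ω₂ lam β γ : ℝ} (hω : 0 < ω₂) (hl : 0 < lam) (hβ : 0 < β) (hγ : 0 < γ) {T : ℝ} (hT : 0 < T) :
    ∃ c r₀ : ℝ, 0 < c ∧ 0 < r₀ ∧ ∀ N : ℕ, 2 ≤ N → ∀ t : ℝ, 0 ≤ t →
      fnorm ω₂ lam β γ T N t + (2 * γ / T) * ∫ s in Ioc (0 : ℝ) t, ((pairCorr ω₂ lam β γ T N s) ^ 2 +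
        (∫ z, z.2 (Fin.last N) * fcast ω₂ lam β γ T N s z ∂((pinnedChain ω₂ lam β γ).gibbsMeasure (N + 1) T)) ^ 2) ≤
          T - c * (min t r₀) ^ 5 :=
  anharmonicLoss_allTimes ω₂ lam β γ hω hl hβ hγ T hT

/-! ## Line census (lead c7, cycle 1, tail): the two CUMULANT channels carry a fixed `N`-uniform weight

The crux's integrand is the FAR cumulant channel `C_N − 2r_N²`; its same-site twin is the NEAR channel `A_N − 2a_N²`
(`A_N(t) = Cov_{μ₀}(p₀², K_t p₀²)`). Strict forecast budget (p157590) + the Kundu–Dhar–Narayan sum rule `∫₀^∞(A_N + C_N) = T²/γ`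
(`IncoherentBounded.sumRule`) give an `N`-uniform floor for their SUM (`…IncoherentChannelCumulantFloor.lean`, lead); both channels vanish
identically at `lam = β = 0` (Wick). The crux says the far share is `κT²/(γ²N)(1 + o(1))`; hence it forces the near share to stay order one. -/

/-- **`N`-uniform cumulant floor** (`cumulantChannels_floor`, lead): `∃ c > 0, ∀ N ≥ 2, ∫₀^∞(C_N − 2r_N²) + ∫₀^∞(A_N − 2a_N²) ≥ c`. [folklore] -/
theorem engine_cumulantChannels_floor {ω₂ lam β γ : ℝ} (hω : 0 < ω₂) (hl : 0 < lam) (hβ : 0 < β) (hγ : 0 < γ) {T : ℝ} (hT : 0 < T) :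
    ∃ c : ℝ, 0 < c ∧ ∀ N : ℕ, 2 ≤ N → c ≤ (∫ t in Ioi (0 : ℝ), (powerCov ω₂ lam β γ T N t - 2 * (pairCorr ω₂ lam β γ T N t) ^ 2)) +
      ∫ t in Ioi (0 : ℝ), ((∫ z, (z.2 0 ^ 2 - T) * (∫ y, (y.2 0 ^ 2 - T)
        ∂((pinnedChain ω₂ lam β γ).transitionKernel (N + 1) T T t.toNNReal z)) ∂((pinnedChain ω₂ lam β γ).gibbsMeasure (N + 1) T)) -
        2 * (∫ z, z.2 (Fin.last N) * fcast ω₂ lam β γ T N t z ∂((pinnedChain ω₂ lam β γ).gibbsMeasure (N + 1) T)) ^ 2) :=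
  cumulantChannels_floor ω₂ lam β γ hω hl hβ hγ T hT

/-- **The crux forces the NEAR cumulant channel to stay order one** (`nearCumulantChannel_of_incoherentChannel`, lead): if
`IncoherentChannel` then eventually `∫₀^∞(A_N − 2a_N²) ≥ c > 0` — all but a `1/N` fraction of the incoherent budget is re-absorbed at the
bath where it was injected. A NECESSARY CONDITION for the crux at route level (like `crux_forces_conductanceFloor`). [folklore] -/
theorem crux_forces_nearCumulantChannel (h : IncoherentChannel) {ω₂ lam β γ : ℝ} (hω : 0 < ω₂) (hl : 0 < lam) (hβ : 0 < β)
    (hγ : 0 < γ) {T : ℝ} (hT : 0 < T) :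
    ∃ c : ℝ, 0 < c ∧ ∀ᶠ N : ℕ in atTop, c ≤ ∫ t in Ioi (0 : ℝ), ((∫ z, (z.2 0 ^ 2 - T) * (∫ y, (y.2 0 ^ 2 - T)
        ∂((pinnedChain ω₂ lam β γ).transitionKernel (N + 1) T T t.toNNReal z)) ∂((pinnedChain ω₂ lam β γ).gibbsMeasure (N + 1) T)) -
        2 * (∫ z, z.2 (Fin.last N) * fcast ω₂ lam β γ T N t z ∂((pinnedChain ω₂ lam β γ).gibbsMeasure (N + 1) T)) ^ 2) :=
  nearCumulantChannel_of_incoherentChannel h ω₂ lam β γ hω hl hβ hγ T hT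


/-! ## Lead c9, cycle 1 (2026-08-17): the FOUR-POINT LIGHT CONE — causality for the crux kernel `C_N` itself (registered stubs of this cycle)

The landed `stub_lightCone` (p92940) light-cones the quantities routed through the MEAN forecast (`r_N²`, `P_N`; Jensen in the
noise). The crux kernel `C_N(t) = Cov_{μ₀}(p_0², K_t p_N²)` needs the PATHWISE two-copy light cone (helper 7,
`lightCone_propagation_lintegral`) read through Hölder instead: with `a = p_N(Φ_t(z,B))`, `b = p_N(Φ_t(z̃,B))` (same noise, `z̃` = `z`
with `p_0` resampled from `N(0,T)`), `C_N(t) = ∫ p_0²(a² − b²)` and `C_N(t)² ≤ (2M₈ + 2M₄)·E[(a − b)²]`, so `|C_N(t)| ≤ ε_N` on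
`t ≤ N^η` with `N^{1+η}ε_N → 0` (`powerCov_lightCone`, lead; the two-regime real analysis is the abstract `lightCone_rate_of_sq_le`).
Consequences: the causal window of the FULL crux integrand carries nothing (`lightConePiece_of_powerCovLightCone` = piece 1 of the
strategist's D5 time-window split, census Part A), and the crux and the conjunct have POST-CONE NORMAL FORMS
(`incoherentChannel_iff_postCone_of_powerCovLightCone`, `fouriersLaw_iff_postConeKubo_of_powerCovLightCone`): for every `η ∈ (0,1)` only
times `t > N^η` matter. HONEST CENSUS: this is the soft (causal) end of the crux; the diffusive window `N^η < t ≲ N²` and the tail stay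
the whole open content (`stub_varianceLimit` ≡ FouriersLaw mod engine, p115953); standing verdict promote-stub. -/

/-- **Registered stub (c9) `lightCone_rate_of_sq_le` — LANDED** (p163209, `Theorems/…IncoherentChannelLightConeRate.lean`) — the two-regime real analysis of a Gibbs-mean light cone, abstractly: a family
`X_N(t)` with `X_N(t)² ≤ K₂·(4A e^Λ Λ^N/N! + C_k t^{2^k}√(N+1)/Λ^{2^k})` for all `Λ > 0` and every `k` is super-polynomially small in
the window `t ≤ N^η`, `η < 1` (`Λ = (N+1)/8`, `2^k ≥ 5/(1−η)`, as in the proof of `stub_lightCone`). [folklore] -/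
theorem lightCone_rate_of_sq_le {X : ℕ → ℝ → ℝ} {K₂ A : ℝ} (hK : 0 ≤ K₂) (hA : 0 ≤ A)
    (hX : ∀ k : ℕ, ∃ C : ℝ, 0 ≤ C ∧ ∀ (N : ℕ) (t : ℝ), 0 ≤ t → ∀ Λ : ℝ, 0 < Λ →
      (X N t) ^ 2 ≤ K₂ * (4 * A * (Real.exp Λ * Λ ^ N / N.factorial) + C * t ^ (2 ^ k) * Real.sqrt (N + 1) / Λ ^ (2 ^ k)))
    {η : ℝ} (hη : 0 < η) (hη1 : η < 1) :
    ∃ ε : ℕ → ℝ, Tendsto (fun N : ℕ => (N : ℝ) ^ (1 + η) * ε N) atTop (𝓝 0) ∧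
      ∀ (N : ℕ) (t : ℝ), 0 ≤ t → t ≤ (N : ℝ) ^ η → |X N t| ≤ ε N :=
  Summit.AtomisticToContinuum.FouriersLaw.Theorems.PhononMeanFreePath.lightCone_rate_of_sq_le hK hA hX hη hη1

/-- **Registered stub (lead c9) `powerCov_lightCone` — LANDED** (p164119, `Theorems/…IncoherentChannelPowerCovLightCone.lean`, reduction `powerCov_sq_le_propagation`) — THE FOUR-POINT LIGHT CONE: for the pinned chain (`ω₂ > 0`, `lam, β, γ ≥ 0`,
harmonic corner included) at `T > 0` and every `η ∈ (0,1)` there is `ε_N` with `N^{1+η}ε_N → 0` and `|C_N(t)| ≤ ε_N` for all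
`0 ≤ t ≤ N^η`, all `N`: the power covariance of the two END kinetic energies vanishes super-polynomially before a signal can cross. [folklore] -/
theorem powerCov_lightCone :
    ∀ ω₂ lam β γ : ℝ, 0 < ω₂ → 0 ≤ lam → 0 ≤ β → 0 ≤ γ → ∀ T : ℝ, 0 < T → ∀ η : ℝ, 0 < η → η < 1 →
      ∃ ε : ℕ → ℝ, Tendsto (fun N : ℕ => (N : ℝ) ^ (1 + η) * ε N) atTop (𝓝 0) ∧
        ∀ (N : ℕ) (t : ℝ), 0 ≤ t → t ≤ (N : ℝ) ^ η → |powerCov ω₂ lam β γ T N t| ≤ ε N :=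
  Summit.AtomisticToContinuum.FouriersLaw.Theorems.PhononMeanFreePath.powerCov_lightCone

/-- **Registered stub (c9) `lightConePiece_of_powerCovLightCone` — LANDED** (p163616, `Theorems/…IncoherentChannelPostCone.lean`) — D5 piece 1 (strategist census Part A): given the four-point light
cone, the causal window of the FULL crux integrand carries nothing, `N(γ²/T²)∫_{(0,N^η]}(C_N − 2r_N²) → 0` for every `η ∈ (0,1)` (with the
landed `stub_lightCone` for `r_N²`; no integrability needed on a finite window). [folklore] -/
theorem lightConePiece_of_powerCovLightCone
    (hC : ∀ ω₂ lam β γ : ℝ, 0 < ω₂ → 0 < lam → 0 < β → 0 < γ → ∀ T : ℝ, 0 < T → ∀ η : ℝ, 0 < η → η < 1 →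
      ∃ ε : ℕ → ℝ, Tendsto (fun N : ℕ => (N : ℝ) ^ (1 + η) * ε N) atTop (𝓝 0) ∧
        ∀ (N : ℕ) (t : ℝ), 0 ≤ t → t ≤ (N : ℝ) ^ η → |powerCov ω₂ lam β γ T N t| ≤ ε N)
    {η : ℝ} (hη : 0 < η) (hη1 : η < 1) :
    ∀ ω₂ lam β γ : ℝ, 0 < ω₂ → 0 < lam → 0 < β → 0 < γ → ∀ T : ℝ, 0 < T →
      Tendsto (fun N : ℕ => (N : ℝ) * (γ ^ 2 / T ^ 2) *
        ∫ t in Ioc (0 : ℝ) ((N : ℝ) ^ η), (powerCov ω₂ lam β γ T N t - 2 * (pairCorr ω₂ lam β γ T N t) ^ 2))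
        atTop (𝓝 0) :=
  Summit.AtomisticToContinuum.FouriersLaw.Theorems.PhononMeanFreePath.lightConePiece_of_powerCovLightCone hC hη hη1

/-- **Registered stub (c9) `incoherentChannel_iff_postCone_of_powerCovLightCone` — LANDED** (p163616, `Theorems/…IncoherentChannelPostCone.lean`) — POST-CONE NORMAL FORM OF THE CRUX: given the
four-point light cone, for every `η ∈ (0,1)`, `IncoherentChannel ↔ ∀ params > 0, ∃ κ > 0, N(γ²/T²)∫_{(N^η,∞)}(C_N − 2r_N²) → κ`
(fixed-`N` integrability of both terms is landed: `powerCov_integrableOn`, `IncoherentBounded.rN_sq_integrableOn`). [folklore] -/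
theorem incoherentChannel_iff_postCone_of_powerCovLightCone
    (hC : ∀ ω₂ lam β γ : ℝ, 0 < ω₂ → 0 < lam → 0 < β → 0 < γ → ∀ T : ℝ, 0 < T → ∀ η : ℝ, 0 < η → η < 1 →
      ∃ ε : ℕ → ℝ, Tendsto (fun N : ℕ => (N : ℝ) ^ (1 + η) * ε N) atTop (𝓝 0) ∧
        ∀ (N : ℕ) (t : ℝ), 0 ≤ t → t ≤ (N : ℝ) ^ η → |powerCov ω₂ lam β γ T N t| ≤ ε N)
    {η : ℝ} (hη : 0 < η) (hη1 : η < 1) :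
    IncoherentChannel ↔
      ∀ ω₂ lam β γ : ℝ, 0 < ω₂ → 0 < lam → 0 < β → 0 < γ → ∀ T : ℝ, 0 < T →
        ∃ κ : ℝ, 0 < κ ∧ Tendsto (fun N : ℕ => (N : ℝ) * (γ ^ 2 / T ^ 2) *
          ∫ t in Ioi ((N : ℝ) ^ η), (powerCov ω₂ lam β γ T N t - 2 * (pairCorr ω₂ lam β γ T N t) ^ 2))
          atTop (𝓝 κ) :=
  Summit.AtomisticToContinuum.FouriersLaw.Theorems.PhononMeanFreePath.incoherentChannel_iff_postCone_of_powerCovLightCone hC hη hη1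

/-- **Registered stub (c9) `fouriersLaw_iff_postConeKubo_of_powerCovLightCone` — LANDED** (p163851, `Theorems/…IncoherentChannelPostConeKubo.lean`) — POST-CONE KUBO FORM OF THE CONJUNCT: given the
four-point light cone, for every `η ∈ (0,1)`, `FouriersLaw ↔ ∀ params > 0, ∃ κ > 0, N(γ²/T²)∫_{(N^η,∞)} C_N → κ` (from the unconditional
`fouriersLaw_iff_kuboForm`, p93864, and `powerCov_integrableOn`): the two-terminal conductance has no pre-causal part. [folklore] -/
theorem fouriersLaw_iff_postConeKubo_of_powerCovLightCone
    (hC : ∀ ω₂ lam β γ : ℝ, 0 < ω₂ → 0 < lam → 0 < β → 0 < γ → ∀ T : ℝ, 0 < T → ∀ η : ℝ, 0 < η → η < 1 →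
      ∃ ε : ℕ → ℝ, Tendsto (fun N : ℕ => (N : ℝ) ^ (1 + η) * ε N) atTop (𝓝 0) ∧
        ∀ (N : ℕ) (t : ℝ), 0 ≤ t → t ≤ (N : ℝ) ^ η → |powerCov ω₂ lam β γ T N t| ≤ ε N)
    {η : ℝ} (hη : 0 < η) (hη1 : η < 1) :
    _root_.FouriersLaw ↔
      ∀ ω₂ lam β γ : ℝ, 0 < ω₂ → 0 < lam → 0 < β → 0 < γ → ∀ T : ℝ, 0 < T →
        ∃ κ : ℝ, 0 < κ ∧ Tendsto (fun N : ℕ => (N : ℝ) * (γ ^ 2 / T ^ 2) *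
          ∫ t in Ioi ((N : ℝ) ^ η), powerCov ω₂ lam β γ T N t) atTop (𝓝 κ) :=
  Summit.AtomisticToContinuum.FouriersLaw.Theorems.PhononMeanFreePath.fouriersLaw_iff_postConeKubo_of_powerCovLightCone hC hη hη1

/-! ### Compositions of the c9 stubs (sorry-free: all five c9 stubs are landed) -/

/-- The four-point light cone at the crux's (strictly positive) parameters, in the hypothesis shape of the worker stubs. [folklore] -/
theorem powerCovLightCone_pos :
    ∀ ω₂ lam β γ : ℝ, 0 < ω₂ → 0 < lam → 0 < β → 0 < γ → ∀ T : ℝ, 0 < T → ∀ η : ℝ, 0 < η → η < 1 →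
      ∃ ε : ℕ → ℝ, Tendsto (fun N : ℕ => (N : ℝ) ^ (1 + η) * ε N) atTop (𝓝 0) ∧
        ∀ (N : ℕ) (t : ℝ), 0 ≤ t → t ≤ (N : ℝ) ^ η → |powerCov ω₂ lam β γ T N t| ≤ ε N :=
  fun ω₂ lam β γ hω hl hβ hγ T hT η hη hη1 => powerCov_lightCone ω₂ lam β γ hω hl.le hβ.le hγ.le T hT η hη hη1

/-- **D5 piece 1 is a theorem (c9, sorry-free)**: `N(γ²/T²)∫_{(0,N^η]}(C_N − 2r_N²) → 0` for every `η ∈ (0,1)`. [folklore] -/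
theorem crux_lightConePiece {η : ℝ} (hη : 0 < η) (hη1 : η < 1) :
    ∀ ω₂ lam β γ : ℝ, 0 < ω₂ → 0 < lam → 0 < β → 0 < γ → ∀ T : ℝ, 0 < T →
      Tendsto (fun N : ℕ => (N : ℝ) * (γ ^ 2 / T ^ 2) *
        ∫ t in Ioc (0 : ℝ) ((N : ℝ) ^ η), (powerCov ω₂ lam β γ T N t - 2 * (pairCorr ω₂ lam β γ T N t) ^ 2))
        atTop (𝓝 0) :=
  lightConePiece_of_powerCovLightCone powerCovLightCone_pos hη hη1

/-- **Post-cone normal form of the crux (c9, sorry-free)**: for every `η ∈ (0,1)`, the crux is the statement that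
`N(γ²/T²)∫_{(N^η,∞)}(C_N − 2r_N²)` converges to a positive limit. [folklore] -/
theorem crux_iff_postCone {η : ℝ} (hη : 0 < η) (hη1 : η < 1) :
    IncoherentChannel ↔
      ∀ ω₂ lam β γ : ℝ, 0 < ω₂ → 0 < lam → 0 < β → 0 < γ → ∀ T : ℝ, 0 < T →
        ∃ κ : ℝ, 0 < κ ∧ Tendsto (fun N : ℕ => (N : ℝ) * (γ ^ 2 / T ^ 2) *
          ∫ t in Ioi ((N : ℝ) ^ η), (powerCov ω₂ lam β γ T N t - 2 * (pairCorr ω₂ lam β γ T N t) ^ 2))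
          atTop (𝓝 κ) :=
  incoherentChannel_iff_postCone_of_powerCovLightCone powerCovLightCone_pos hη hη1

/-- **Post-cone Kubo form of the conjunct (c9, sorry-free)**: for every `η ∈ (0,1)`,
`FouriersLaw ↔ ∀ params > 0, ∃ κ > 0, N(γ²/T²)∫_{(N^η,∞)} C_N → κ`. [folklore] -/
theorem fouriersLaw_iff_postConeKubo {η : ℝ} (hη : 0 < η) (hη1 : η < 1) :
    _root_.FouriersLaw ↔
      ∀ ω₂ lam β γ : ℝ, 0 < ω₂ → 0 < lam → 0 < β → 0 < γ → ∀ T : ℝ, 0 < T →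
        ∃ κ : ℝ, 0 < κ ∧ Tendsto (fun N : ℕ => (N : ℝ) * (γ ^ 2 / T ^ 2) *
          ∫ t in Ioi ((N : ℝ) ^ η), powerCov ω₂ lam β γ T N t) atTop (𝓝 κ) :=
  fouriersLaw_iff_postConeKubo_of_powerCovLightCone powerCovLightCone_pos hη hη1

end Summit.AtomisticToContinuum.FouriersLaw.Cruxes.IncoherentChannel.TwoHorizonsForecastLoss

end
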